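import Literature.Analysis.FluidPDE.LocalTypeIMorrey
import Literature.Analysis.FluidPDE.Seregin2020ScaledEnergyBoundsE
import Literature.Analysis.FluidPDE.NSSuitableESSProofs
import Literature.Analysis.FluidPDE.LocalTypeILscPressure
import HarnessLib

/-!
# Albritton–Barker 2019, Lemma 2.6 (Morrey-type estimates), discharged

Analysis/FluidPDE proof file (everything proved; no definitions, no named facts), sibling of
`LocalTypeIMorrey.lean`, which vendors D. Albritton, T. Barker, *On local Type I singularities
of the Navier–Stokes equations and Liouville theorems*, J. Math. Fluid Mech. 21 (2019) =
arXiv:1811.00502, **Lemma 2.6** (rescaled-energy cases) as the named fact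
`Literature.Analysis.FluidPDE.albrittonBarker2019_lemma_2_6`: for a suitable weak solution
`(u, p)` in the parabolic ball `Q(z, 1)` (Def. 2.1) and a weak spatial gradient `G = ∇u` there,
if ONE of `sup_{Q' ⊂ Q(z,1)} A(Q')`, `sup C(Q')`, `sup E(Q')` is finite, then
`𝐈(Q(z, R)) = sup_{Q' ⊂ Q(z,R)} (A + C + D + E)(Q') < ∞` for every `0 < R < 1`. This file proves
`albrittonBarker2019_lemma_2_6_holds`.

## The printed proof and its rendering

A–B print the lemma without proof, referring to G. Seregin, *Estimates of suitable weak
solutions to the Navier–Stokes equations in critical Morrey spaces*, Zap. Nauchn. Sem. POMI 336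
(2006) 199–210 = J. Math. Sci. 143 (2007) 2961–2968 (their [SereginCriticalMorrey2006]), and
remark (arXiv p. 6): "it is crucial that `(v,q)` is already assumed to be suitable, since the
proof relies on the local energy inequality. Indeed, the estimate which gives (𝐈 bound) depends
on the background quantities `C(1)` and `D(1)`." The centred statement behind it is printed,
with exactly this dependence of the constants, as Lemma 2.1 of G. Seregin, *Regularity for
suitable weak solutions to the Navier–Stokes equations in critical Morrey spaces*,
arXiv:math/0607537 = J. Math. Sci. 143 (2007) (held; bib key `Seregin2006`; "A proof of Lemma 2.1
is based upon estimates (2.1)–(2.6) and presented in [S8]", [S8] being the POMI paper above):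
for a suitable weak solution in `Q`, (a) `sup_{0<r≤1} E(r) = E₀ < ∞` ⇒
`A^{3/2}(r) + C(r) + D₀²(r) ≤ d(E₀)(r^{1/2}(A^{3/2}(1) + D₀²(1)) + 1)`, `0 < r ≤ 1/4`;
(b) `sup C(r) = C₀ < ∞` ⇒ `A(r) + D₀(r) + E(r) ≤ c(r² D₀(1) + C₀ + C₀^{2/3})`, `0 < r ≤ 1/2`;
(c) `sup A(r) = A₀ < ∞` ⇒ `C^{4/3}(r) + D₀(r) + E(r) ≤ e(A₀)(r²(D₀(1) + E(1)) + 1)`,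
`0 < r ≤ 1/2` — the constants depend only on the bound and on the background quantities at the
unit scale. Seregin's argument is the standard one between the scaled quantities `A, E, C, D`
of a suitable weak solution — local energy inequality, decay estimate for the pressure,
multiplicative inequality ((2.1)–(2.6) loc. cit.) — iterated along the scales `θᵏ r₀` at a
FIXED centre; the tree has it, centre by centre, as
`Seregin2020.scaledEnergies_bounded_of_cknC_le / _of_cknAEss_le / _of_cknE_le`
(`Seregin2020ScaledEnergyBounds{,A,E}.lean`): "`C` (resp. `A`, `E`) bounded on the cylinders
`Q(z', r)`, `0 < r ≤ r₀` ⇒ `A + E + C + D ≤ K` on `Q(z', r)`, `0 < r ≤ r₀/2`", but with `∃ K`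
AFTER the solution and the centre, i.e. without Lemma 2.1's dependence statement.

Albritton–Barker's `𝐈` is a supremum over ALL parabolic sub-balls (any centre), so the
discharge needs the centred estimate with a constant UNIFORM in the centre and the solution, as
in Seregin's Lemma 2.1: `K` depends only on the bound `M` and on bounds for the background
quantities at the base radius `r₀` (A–B's remark on `C(1)`, `D(1)`). Sections 1–3 below re-run
the three tree proofs verbatim with the quantifiers in this order
(`Seregin2020.scaledEnergies_bounded_of_cknC_le_unif`, `…_of_cknAEss_le_unif`,
`…_of_cknE_le_unif`): the constants of the tree proofs are explicit closed forms in `M`,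
`D(r₀)`, `E(r₀)`, `A(r₀)` and universal constants, so nothing but the bookkeeping changes
(boundedness only; Lemma 2.1's rates `r^{1/2}`, `r²` in front of the background terms are not
tracked).

Section 4 is the covering bookkeeping of Lemma 2.6 (the only part specific to A–B): fix
`0 < R < 1`, `δ = 1 - R`. A sub-ball `Q(z', r') ⊆ Q(z, R)` has `Q(z', δ) ⊆ Q(z, 1)` (its centre
lies in `B(x, R)`, its times in `]t - R², t]`, and `R² + δ² ≤ 1`), so
* for `r' ≤ δ/2` the uniform centred estimate at `z'` with base radius `δ` applies — its
  hypothesis "`E ≤ M` (resp. `A`, `C`) on `Q(z', ρ)`, `ρ ≤ δ`" is A–B's all-balls hypothesis, and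
  the background quantities `A(δ; z'), E(δ; z'), D(δ; z')` are at most `δ⁻¹ A(1; z)`,
  `δ⁻¹ E(1; z)`, `δ⁻² D(1; z)`, finite by Def. 2.1's global class on `Q(z, 1)`
  (`esssup_t ∫_B |u|² < ∞`, `∇u ∈ L²` — transferred to the given `G` by the a.e. uniqueness of
  weak gradients —, `q ∈ L^{3/2}`);
* for `r' > δ/2` the four quantities of `Q(z', r') ⊆ Q(z, 1)` are at most `(2/δ)²` times the
  background ones, `C(1; z) < ∞` coming from the multiplicative inequality
  (`Seregin2020.exists_cknC_le_finer`).
A–B's mean-free pressure quantity `D` (`cknDOsc`) is at most `2^{3/2}` times the plain `D`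
(`cknD`) of the tree estimates (Jensen on the ball average, `cknDOsc_le_mul_cknD`).

## References

* D. Albritton, T. Barker, J. Math. Fluid Mech. 21 (2019) = arXiv:1811.00502, §1 (`A, C, D, E,
  𝐈`), Def. 2.1, **Lemma 2.6** and the remark following it (arXiv p. 6). [`AlbrittonBarker2019`]
* G. Seregin, *Regularity for suitable weak solutions to the Navier–Stokes equations in critical
  Morrey spaces*, arXiv:math/0607537 = J. Math. Sci. 143 (2007): §2, (2.1)–(2.6) and
  **Lemma 2.1** (the centred statement with the dependence of its constants). [`Seregin2006`]
* G. Seregin, *Estimates of suitable weak solutions to the Navier–Stokes equations in critical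
  Morrey spaces*, Zap. Nauchn. Sem. POMI 336 (2006) 199–210 = J. Math. Sci. 143 (2007) 2961–2968
  (the proof of Lemma 2.1; A–B's [SereginCriticalMorrey2006]; not held).
* G. Seregin, *Lecture Notes on Regularity Theory for the Navier–Stokes Equations* (2014), §6.1,
  Lemmas 6.2–6.4, proof of Thm. 1.4. [`Seregin2014`]
* G. Seregin, Anal. Math. Phys. 10 (2020), Paper 46, remark after Def. 1.7 (the centred
  statement discharged in `Seregin2020ScaledEnergyBounds{,A,E}.lean`). [`Seregin2020`]
-/

noncomputable section

open MeasureTheory Set Function Filter Topology TopologicalSpace Metric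
open scoped NNReal ENNReal

namespace Literature.Analysis.FluidPDE

namespace Seregin2020

/-! ### 1. Bounded `C`, uniform constant -/

/-- **The case of a bounded cubic quantity, with a constant uniform in the solution and the
centre** (Seregin 2006, Lemma 2.1 (b): "Let `sup_{0<r≤1} C(r) = C₀ < +∞`. Then
`A(r) + D₀(r) + E(r) ≤ c(r² D₀(1) + C₀ + C₀^{2/3})` for all `0 < r ≤ 1/2`"; boundedness only):
for all `M, D₀` there is `K` such that for every suitable weak solution `(u, p)` of the unforced
Navier–Stokes equations (`ν = 1`) on an open `Q`, every weak spatial gradient `G` of `u` on `Q`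
and every backward cylinder `Q_{r₀}(z) ⊆ Q` (possibly touching the top of `Q`) with
`D(r₀; z) ≤ D₀` and `C(r; z) ≤ M` for `0 < r ≤ r₀`, one has `A + E + C + D ≤ K` on `Q_r(z)`,
`0 < r ≤ r₀/2`. The proof of `scaledEnergies_bounded_of_cknC_le` (Seregin 2020, remark after
Def. 1.7), with its (explicit) constant written before the data.
[cite: Seregin2006, Lemma 2.1 (b) (arXiv:math/0607537 §2); Seregin2020 remark after Def. 1.7] -/
theorem scaledEnergies_bounded_of_cknC_le_unif (M D₀ : ℝ≥0) :
    ∃ K : ℝ≥0, ∀ (Q : Opens (ℝ × EuclideanSpace ℝ (Fin 3)))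
      (u : ℝ → EuclideanSpace ℝ (Fin 3) → EuclideanSpace ℝ (Fin 3))
      (p : ℝ → EuclideanSpace ℝ (Fin 3) → ℝ)
      (G : ℝ → EuclideanSpace ℝ (Fin 3) → EuclideanSpace ℝ (Fin 3) →L[ℝ] EuclideanSpace ℝ (Fin 3)),
      IsSuitableWeakSolutionOn Q 1 0 u p → HasWeakSpatialGradientOn Q u G →
      ∀ (z : ℝ × EuclideanSpace ℝ (Fin 3)) (r₀ : ℝ), 0 < r₀ →
        parabolicCylinder r₀ z ⊆ (Q : Set (ℝ × EuclideanSpace ℝ (Fin 3))) →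
        cknD r₀ z p ≤ D₀ → (∀ r ∈ Ioc (0 : ℝ) r₀, cknC r z u ≤ M) →
        ∀ r ∈ Ioc (0 : ℝ) (r₀ / 2), cknAEss r z u + cknE r z G + cknC r z u + cknD r z p ≤ K := by
  -- the pressure decay estimate and a ratio `θ` absorbing its constant
  obtain ⟨c, hc⟩ := seregin_sverak_pressure_decay_holds.ratio
  obtain ⟨θ, hθ, hθhalf, hcθ⟩ := exists_ratio_mul_le_half c
  have hθ1 : θ ≤ 1 := hθhalf.trans (by norm_num)
  obtain ⟨c₁, c₂, c₃, HT⟩ := localEnergyBound_top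
  -- ### the constant
  set B : ℝ≥0∞ := (D₀ : ℝ≥0∞) + 2 * (c * ENNReal.ofReal ((θ⁻¹) ^ 2) * M) with hB
  have hBtop : B ≠ ∞ := by
    refine ENNReal.add_ne_top.2 ⟨ENNReal.coe_ne_top, ENNReal.mul_ne_top ENNReal.ofNat_ne_top ?_⟩
    exact ENNReal.mul_ne_top (ENNReal.mul_ne_top ENNReal.coe_ne_top ENNReal.ofReal_ne_top)
      ENNReal.coe_ne_top
  set B' : ℝ≥0∞ := ENNReal.ofReal (θ⁻¹) ^ 2 * B with hB'
  have hB'top : B' ≠ ∞ := ENNReal.mul_ne_top (ENNReal.pow_ne_top ENNReal.ofReal_ne_top) hBtop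
  set L : ℝ≥0∞ := c₁ * (M : ℝ≥0∞) ^ (2 / 3 : ℝ) + c₂ * M +
    c₃ * (B' ^ (2 / 3 : ℝ) * (M : ℝ≥0∞) ^ (1 / 3 : ℝ)) + M + B' with hL
  have hLtop : L ≠ ∞ := by
    have hM23 : (M : ℝ≥0∞) ^ (2 / 3 : ℝ) ≠ ∞ := ENNReal.rpow_ne_top_of_nonneg (by norm_num)
      ENNReal.coe_ne_top
    have hM13 : (M : ℝ≥0∞) ^ (1 / 3 : ℝ) ≠ ∞ := ENNReal.rpow_ne_top_of_nonneg (by norm_num)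
      ENNReal.coe_ne_top
    have hB23 : B' ^ (2 / 3 : ℝ) ≠ ∞ := ENNReal.rpow_ne_top_of_nonneg (by norm_num) hB'top
    rw [hL]
    refine ENNReal.add_ne_top.2 ⟨ENNReal.add_ne_top.2 ⟨ENNReal.add_ne_top.2
      ⟨ENNReal.add_ne_top.2 ⟨?_, ?_⟩, ?_⟩, ENNReal.coe_ne_top⟩, hB'top⟩
    · exact ENNReal.mul_ne_top ENNReal.coe_ne_top hM23
    · exact ENNReal.mul_ne_top ENNReal.coe_ne_top ENNReal.coe_ne_top
    · exact ENNReal.mul_ne_top ENNReal.coe_ne_top (ENNReal.mul_ne_top hB23 hM13)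
  refine ⟨L.toNNReal, fun Q u p G hsw hG z r₀ hr₀ hQ hD₀ hM r hr => ?_⟩
  rw [ENNReal.coe_toNNReal hLtop]
  -- ### Step 1: `D` along the scales `θᴶ r₀`
  have hDJ : ∀ J : ℕ, cknD (θ ^ J * r₀) z p ≤ B := by
    intro J
    have hCj : ∀ j < J, cknC (θ ^ j * r₀) z u ≤ M := fun j _ =>
      hM _ ⟨by positivity, mul_le_of_le_one_left hr₀.le (pow_le_one₀ hθ.le hθ1)⟩
    refine (cknD_iterate_le_of_pressure_decay hc hθ hθ1 hcθ hsw.distributional hr₀ hQ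
      hCj).trans ?_
    rw [hB]
    gcongr
    calc (2⁻¹ : ℝ≥0∞) ^ J * cknD r₀ z p ≤ 1 * cknD r₀ z p := by
          gcongr
          exact pow_le_one₀ zero_le (ENNReal.inv_le_one.2 one_le_two)
      _ = cknD r₀ z p := one_mul _
      _ ≤ D₀ := hD₀
  -- ### Step 2: `D` at every scale `0 < r ≤ r₀`
  have hDr : ∀ r ∈ Ioc (0 : ℝ) r₀, cknD r z p ≤ B' := by
    intro r hr
    obtain ⟨J, hJ1, hJ2⟩ := exists_nat_pow_near_of_lt_one (div_pos hr.1 hr₀)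
      ((div_le_one hr₀).2 hr.2) hθ (by linarith)
    have hle : r ≤ θ ^ J * r₀ := by rwa [div_le_iff₀ hr₀] at hJ2
    have hlt : θ ^ J * r₀ < θ⁻¹ * r := by
      rw [lt_div_iff₀ hr₀] at hJ1
      have : θ ^ J * r₀ = θ⁻¹ * (θ ^ (J + 1) * r₀) := by
        rw [pow_succ]; field_simp
      rw [this]
      exact mul_lt_mul_of_pos_left hJ1 (inv_pos.2 hθ)
    have hsub : parabolicCylinder r z ⊆ parabolicCylinder (θ ^ J * r₀) z :=
      parabolicCylinder_mono hr.1.le hle z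
    calc cknD r z p ≤ ENNReal.ofReal (θ ^ J * r₀ / r) ^ 2 * cknD (θ ^ J * r₀) z p :=
          cknD_le_mul_of_subset (by positivity) hr.1 hsub p
      _ ≤ ENNReal.ofReal (θ⁻¹) ^ 2 * B := by
          gcongr
          · exact (div_le_iff₀ hr.1).2 hlt.le
          · exact hDJ J
  -- ### Step 3: `A + E` from the local energy bound at the top
  have h2r : 2 * r ∈ Ioc (0 : ℝ) r₀ := ⟨by linarith [hr.1], by linarith [hr.2]⟩
  have hrr : r ∈ Ioc (0 : ℝ) r₀ := ⟨hr.1, by linarith [hr.2]⟩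
  have hAE := HT Q u p G hsw hG z (2 * r) h2r.1
    ((parabolicCylinder_mono (by linarith [hr.1]) h2r.2 z).trans hQ)
  rw [show 2 * r / 2 = r by ring] at hAE
  have hC2 : cknC (2 * r) z u ≤ M := hM _ h2r
  have hD2 : cknD (2 * r) z p ≤ B' := hDr _ h2r
  calc cknAEss r z u + cknE r z G + cknC r z u + cknD r z p
      ≤ (c₁ * cknC (2 * r) z u ^ (2 / 3 : ℝ) + c₂ * cknC (2 * r) z u +
          c₃ * (cknD (2 * r) z p ^ (2 / 3 : ℝ) * cknC (2 * r) z u ^ (1 / 3 : ℝ))) +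
          M + B' := add_le_add (add_le_add hAE (hM r hrr)) (hDr r hrr)
    _ ≤ L := by
        rw [hL]
        gcongr

/-! ### 2. Bounded `A`, uniform constant -/

/-- **The case of a bounded energy quantity, with a constant uniform in the solution and the
centre** (Seregin 2006, Lemma 2.1 (c): "Let `sup_{0<r≤1} A(r) = A₀ < +∞`. Then there exists a
positive constant `e` depending only on `A₀` such that
`C^{4/3}(r) + D₀(r) + E(r) ≤ e(A₀)(r²(D₀(1) + E(1)) + 1)` for all `0 < r ≤ 1/2`"; boundedness
only): for all `M, E₀, D₀` there is `K` such that for every suitable weak solution `(u, p)`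
(unforced, `ν = 1`) on an open `Q`, every weak spatial gradient `G` of `u` on `Q` and every
backward cylinder `Q_{r₀}(z) ⊆ Q` with `E(r₀; z) ≤ E₀`, `D(r₀; z) ≤ D₀` and `A(r; z) ≤ M` for
`0 < r ≤ r₀` (`A = cknAEss`), one has `A + E + C + D ≤ K` on `Q_r(z)`, `0 < r ≤ r₀/2`. The proof
of `scaledEnergies_bounded_of_cknAEss_le` (Seregin 2020, remark after Def. 1.7: iteration for
`Ψ = E + D`, sublinear majorant of `C` by the multiplicative inequality), with its explicit
constant written before the data.
[cite: Seregin2006, Lemma 2.1 (c) (arXiv:math/0607537 §2); Seregin2020 remark after Def. 1.7; Seregin2014 §6.1] -/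
theorem scaledEnergies_bounded_of_cknAEss_le_unif (M E₀ D₀ : ℝ≥0) :
    ∃ K : ℝ≥0, ∀ (Q : Opens (ℝ × EuclideanSpace ℝ (Fin 3)))
      (u : ℝ → EuclideanSpace ℝ (Fin 3) → EuclideanSpace ℝ (Fin 3))
      (p : ℝ → EuclideanSpace ℝ (Fin 3) → ℝ)
      (G : ℝ → EuclideanSpace ℝ (Fin 3) → EuclideanSpace ℝ (Fin 3) →L[ℝ] EuclideanSpace ℝ (Fin 3)),
      IsSuitableWeakSolutionOn Q 1 0 u p → HasWeakSpatialGradientOn Q u G →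
      ∀ (z : ℝ × EuclideanSpace ℝ (Fin 3)) (r₀ : ℝ), 0 < r₀ →
        parabolicCylinder r₀ z ⊆ (Q : Set (ℝ × EuclideanSpace ℝ (Fin 3))) →
        cknE r₀ z G ≤ E₀ → cknD r₀ z p ≤ D₀ → (∀ r ∈ Ioc (0 : ℝ) r₀, cknAEss r z u ≤ M) →
        ∀ r ∈ Ioc (0 : ℝ) (r₀ / 2), cknAEss r z u + cknE r z G + cknC r z u + cknD r z p ≤ K := by
  -- ### the constants of the three estimates
  obtain ⟨c, hc⟩ := seregin_sverak_pressure_decay_holds.ratio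
  obtain ⟨c₁, c₂, c₃, HT⟩ := localEnergyBound_top
  obtain ⟨C₀, hC₀⟩ := exists_cknC_le_finer
  -- `θ` with `c θ ≤ 1/4`
  obtain ⟨θ, hθ, hθhalf, hcθ2⟩ := exists_ratio_mul_le_half (2 * c)
  have hθ1 : θ ≤ 1 := hθhalf.trans (by norm_num)
  have hcθ : (c : ℝ≥0∞) * ENNReal.ofReal θ ≤ 2⁻¹ * 2⁻¹ := by
    calc (c : ℝ≥0∞) * ENNReal.ofReal θ = 2⁻¹ * (((2 * c : ℝ≥0) : ℝ≥0∞) * ENNReal.ofReal θ) := by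
          push_cast
          rw [← mul_assoc, ← mul_assoc, ENNReal.inv_mul_cancel two_ne_zero ENNReal.ofNat_ne_top,
            one_mul]
      _ ≤ 2⁻¹ * 2⁻¹ := by gcongr
  -- the Young parameter `s` with `(2θ)⁻¹ c₃ s ≤ 1/4`
  set L : ℝ≥0∞ := ENNReal.ofReal ((2 * θ)⁻¹) * c₃ with hL
  have hLtop : L ≠ ∞ := ENNReal.mul_ne_top ENNReal.ofReal_ne_top ENNReal.coe_ne_top
  set s : ℝ≥0∞ := 2⁻¹ * 2⁻¹ * (L + 1)⁻¹ with hs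
  have h2i0 : (2⁻¹ : ℝ≥0∞) ≠ 0 := ENNReal.inv_ne_zero.2 ENNReal.ofNat_ne_top
  have h2it : (2⁻¹ : ℝ≥0∞) ≠ ∞ := ENNReal.inv_ne_top.2 two_ne_zero
  have hs0 : s ≠ 0 := mul_ne_zero (mul_ne_zero h2i0 h2i0)
    (ENNReal.inv_ne_zero.2 (ENNReal.add_ne_top.2 ⟨hLtop, ENNReal.one_ne_top⟩))
  have hstop : s ≠ ∞ := ENNReal.mul_ne_top (ENNReal.mul_ne_top h2it h2it)
    (ENNReal.inv_ne_top.2 (by simp))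
  have hLs : L * s ≤ 2⁻¹ * 2⁻¹ := by
    have h1 : L * (L + 1)⁻¹ ≤ 1 := by
      rw [← div_eq_mul_inv]
      exact ENNReal.div_le_of_le_mul (by rw [one_mul]; exact le_self_add)
    calc L * s = 2⁻¹ * 2⁻¹ * (L * (L + 1)⁻¹) := by rw [hs]; ring
      _ ≤ 2⁻¹ * 2⁻¹ * 1 := by gcongr
      _ = 2⁻¹ * 2⁻¹ := mul_one _
  -- the sublinear majorant of `C`: `C(R) ≤ γ (M + E(R))^{3/4}`, `γ = C₀ M^{3/4}`
  set γ : ℝ≥0∞ := (C₀ : ℝ≥0∞) * (M : ℝ≥0∞) ^ (3 / 4 : ℝ) with hγ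
  have hγtop : γ ≠ ∞ := ENNReal.mul_ne_top ENNReal.coe_ne_top
    (ENNReal.rpow_ne_top_of_nonneg (by norm_num) ENNReal.coe_ne_top)
  -- coefficients of `(M+E)^{1/2}` and `(M+E)^{3/4}`, and the absorption constants
  set α₁ : ℝ≥0∞ := ENNReal.ofReal ((2 * θ)⁻¹) * c₁ * γ ^ (2 / 3 : ℝ) with hα₁
  set α₂ : ℝ≥0∞ := (ENNReal.ofReal ((2 * θ)⁻¹) * (c₂ + c₃ * s⁻¹ ^ 2) +
    c * ENNReal.ofReal (θ⁻¹ ^ 2)) * γ with hα₂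
  have hsi : s⁻¹ ≠ ∞ := ENNReal.inv_ne_top.2 hs0
  have hα₁top : α₁ ≠ ∞ := ENNReal.mul_ne_top
    (ENNReal.mul_ne_top ENNReal.ofReal_ne_top ENNReal.coe_ne_top)
    (ENNReal.rpow_ne_top_of_nonneg (by norm_num) hγtop)
  have hα₂top : α₂ ≠ ∞ := by
    refine ENNReal.mul_ne_top (ENNReal.add_ne_top.2 ⟨?_, ?_⟩) hγtop
    · exact ENNReal.mul_ne_top ENNReal.ofReal_ne_top (ENNReal.add_ne_top.2 ⟨ENNReal.coe_ne_top,
        ENNReal.mul_ne_top ENNReal.coe_ne_top (ENNReal.pow_ne_top hsi)⟩)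
    · exact ENNReal.mul_ne_top ENNReal.coe_ne_top ENNReal.ofReal_ne_top
  set ε : ℝ≥0∞ := 2⁻¹ * 2⁻¹ with hε
  have hε0 : ε ≠ 0 := mul_ne_zero h2i0 h2i0
  have hεtop : ε ≠ ∞ := ENNReal.mul_ne_top h2it h2it
  have hεi : ε⁻¹ ≠ ∞ := ENNReal.inv_ne_top.2 hε0
  set K₁ : ℝ≥0∞ := (α₁ * ε⁻¹ ^ (1 / 2 : ℝ)) ^ (1 / (1 - 1 / 2 : ℝ)) with hK₁
  set K₂ : ℝ≥0∞ := (α₂ * ε⁻¹ ^ (3 / 4 : ℝ)) ^ (1 / (1 - 3 / 4 : ℝ)) with hK₂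
  have hK₁top : K₁ ≠ ∞ := ENNReal.rpow_ne_top_of_nonneg (by norm_num)
    (ENNReal.mul_ne_top hα₁top (ENNReal.rpow_ne_top_of_nonneg (by norm_num) hεi))
  have hK₂top : K₂ ≠ ∞ := ENNReal.rpow_ne_top_of_nonneg (by norm_num)
    (ENNReal.mul_ne_top hα₂top (ENNReal.rpow_ne_top_of_nonneg (by norm_num) hεi))
  set b : ℝ≥0∞ := 2⁻¹ * M + K₁ + K₂ with hb
  have hbtop : b ≠ ∞ := ENNReal.add_ne_top.2 ⟨ENNReal.add_ne_top.2
    ⟨ENNReal.mul_ne_top h2it ENNReal.coe_ne_top, hK₁top⟩, hK₂top⟩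
  -- the level reached by the iteration and the resulting bound on `C`
  set Ψ₀ : ℝ≥0∞ := 2 * b + ((E₀ : ℝ≥0∞) + D₀) with hΨ₀
  have hΨ₀top : Ψ₀ ≠ ∞ := ENNReal.add_ne_top.2
    ⟨ENNReal.mul_ne_top ENNReal.ofNat_ne_top hbtop, ENNReal.add_ne_top.2
      ⟨ENNReal.coe_ne_top, ENNReal.coe_ne_top⟩⟩
  set Cbar : ℝ≥0∞ := γ * (M + ENNReal.ofReal (θ⁻¹) * Ψ₀) ^ (3 / 4 : ℝ) with hCbar
  have hCbartop : Cbar ≠ ∞ := ENNReal.mul_ne_top hγtop (ENNReal.rpow_ne_top_of_nonneg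
    (by norm_num) (ENNReal.add_ne_top.2 ⟨ENNReal.coe_ne_top,
      ENNReal.mul_ne_top ENNReal.ofReal_ne_top hΨ₀top⟩))
  -- the constant of the case `C`
  obtain ⟨K, hK⟩ := scaledEnergies_bounded_of_cknC_le_unif Cbar.toNNReal D₀
  refine ⟨K, fun Q u p G hsw hG z r₀ hr₀ hQ hE₀ hD₀ hM => ?_⟩
  have hE₀' : cknE r₀ z G ≠ ∞ := ne_top_of_le_ne_top ENNReal.coe_ne_top hE₀
  -- ### finiteness of `E` below `r₀`
  have hEfin : ∀ R ∈ Ioc (0 : ℝ) r₀, cknE R z G ≠ ∞ := fun R hR =>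
    ne_top_of_le_ne_top (ENNReal.mul_ne_top ENNReal.ofReal_ne_top hE₀')
      (cknE_le_mul_of_subset hr₀ hR.1 (parabolicCylinder_mono hR.1.le hR.2 z) G)
  -- ### the majorant of `C`
  have hCR : ∀ R ∈ Ioc (0 : ℝ) r₀, cknC R z u ≤ γ * (M + cknE R z G) ^ (3 / 4 : ℝ) := by
    intro R hR
    have hQR : parabolicCylinder R z ⊆ (Q : Set (ℝ × EuclideanSpace ℝ (Fin 3))) :=
      (parabolicCylinder_mono hR.1.le hR.2 z).trans hQ
    have hGR : HasWeakSpatialGradientOn (parabolicCylinderOpens R z) u G :=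
      hG.mono (fun w hw => hQR hw)
    have hAR : cknAEss R z u ≤ M := hM R hR
    have key := hC₀ u G z R hR.1 hGR (ne_top_of_le_ne_top ENNReal.coe_ne_top hAR) (hEfin R hR)
    calc cknC R z u ≤ C₀ * cknAEss R z u ^ (3 / 4 : ℝ) * (cknAEss R z u + cknE R z G) ^ (3 / 4 : ℝ) :=
          key
      _ ≤ C₀ * (M : ℝ≥0∞) ^ (3 / 4 : ℝ) * (M + cknE R z G) ^ (3 / 4 : ℝ) := by gcongr
      _ = γ * (M + cknE R z G) ^ (3 / 4 : ℝ) := by rw [hγ]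
  have hCR23 : ∀ R ∈ Ioc (0 : ℝ) r₀,
      cknC R z u ^ (2 / 3 : ℝ) ≤ γ ^ (2 / 3 : ℝ) * (M + cknE R z G) ^ (1 / 2 : ℝ) := by
    intro R hR
    calc cknC R z u ^ (2 / 3 : ℝ) ≤ (γ * (M + cknE R z G) ^ (3 / 4 : ℝ)) ^ (2 / 3 : ℝ) :=
          ENNReal.rpow_le_rpow (hCR R hR) (by norm_num)
      _ = γ ^ (2 / 3 : ℝ) * (M + cknE R z G) ^ (1 / 2 : ℝ) := by
          rw [ENNReal.mul_rpow_of_nonneg _ _ (by norm_num), ← ENNReal.rpow_mul]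
          norm_num
  -- ### the one-step inequality for `Ψ = E + D`
  have step : ∀ R, 0 < R → R ≤ r₀ →
      cknE (θ * R) z G + cknD (θ * R) z p ≤ (cknE R z G + cknD R z p) / 2 + b := by
    intro R hR0 hRr
    have hR : R ∈ Ioc (0 : ℝ) r₀ := ⟨hR0, hRr⟩
    have hQR : parabolicCylinder R z ⊆ (Q : Set (ℝ × EuclideanSpace ℝ (Fin 3))) :=
      (parabolicCylinder_mono hR0.le hRr z).trans hQ
    set EE := cknE R z G with hEE
    set D := cknD R z p with hDdef
    set C := cknC R z u with hCdef
    set X := (M : ℝ≥0∞) + EE with hX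
    -- the dissipation at `θR` through `R/2`
    have hE1 : cknE (θ * R) z G ≤ ENNReal.ofReal ((2 * θ)⁻¹) *
        (c₁ * C ^ (2 / 3 : ℝ) + c₂ * C + c₃ * (D ^ (2 / 3 : ℝ) * C ^ (1 / 3 : ℝ))) := by
      have hsub : parabolicCylinder (θ * R) z ⊆ parabolicCylinder (R / 2) z :=
        parabolicCylinder_mono (by positivity) (by nlinarith) z
      have hmono := cknE_le_mul_of_subset (half_pos hR0) (mul_pos hθ hR0) hsub G
      have e1 : R / 2 / (θ * R) = (2 * θ)⁻¹ := by field_simp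
      rw [e1] at hmono
      have hT := HT Q u p G hsw hG z R hR0 hQR
      calc cknE (θ * R) z G ≤ ENNReal.ofReal ((2 * θ)⁻¹) * cknE (R / 2) z G := hmono
        _ ≤ ENNReal.ofReal ((2 * θ)⁻¹) * (cknAEss (R / 2) z u + cknE (R / 2) z G) := by
            gcongr; exact le_add_self
        _ ≤ _ := by gcongr
    -- the pressure at `θR`
    have hD1 : cknD (θ * R) z p ≤
        c * (ENNReal.ofReal θ * D + ENNReal.ofReal ((θ⁻¹) ^ 2) * C) :=
      hc Q u p hsw.distributional z R θ hR0 hθ hθ1 hQR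
    -- Young for the mixed term
    have hY : D ^ (2 / 3 : ℝ) * C ^ (1 / 3 : ℝ) ≤ s * D + s⁻¹ ^ 2 * C :=
      rpow_two_thirds_mul_rpow_one_third_le D C hs0 hstop
    -- absorption of the sublinear powers of `X = M + E`
    have hab1 : α₁ * X ^ (1 / 2 : ℝ) ≤ ε * X + K₁ :=
      rpow_le_mul_add (by norm_num) (by norm_num) α₁ X hε0 hεtop
    have hab2 : α₂ * X ^ (3 / 4 : ℝ) ≤ ε * X + K₂ :=
      rpow_le_mul_add (by norm_num) (by norm_num) α₂ X hε0 hεtop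
    -- combine
    calc cknE (θ * R) z G + cknD (θ * R) z p
        ≤ ENNReal.ofReal ((2 * θ)⁻¹) *
            (c₁ * C ^ (2 / 3 : ℝ) + c₂ * C + c₃ * (s * D + s⁻¹ ^ 2 * C)) +
          c * (ENNReal.ofReal θ * D + ENNReal.ofReal ((θ⁻¹) ^ 2) * C) := by
          gcongr
          exact hE1.trans (by gcongr)
      _ = (L * s) * D + (c * ENNReal.ofReal θ) * D +
          ENNReal.ofReal ((2 * θ)⁻¹) * c₁ * C ^ (2 / 3 : ℝ) +
          (ENNReal.ofReal ((2 * θ)⁻¹) * (c₂ + c₃ * s⁻¹ ^ 2) + c * ENNReal.ofReal (θ⁻¹ ^ 2)) * C := by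
          rw [hL]; ring
      _ ≤ (2⁻¹ * 2⁻¹) * D + (2⁻¹ * 2⁻¹) * D +
          ENNReal.ofReal ((2 * θ)⁻¹) * c₁ * (γ ^ (2 / 3 : ℝ) * X ^ (1 / 2 : ℝ)) +
          (ENNReal.ofReal ((2 * θ)⁻¹) * (c₂ + c₃ * s⁻¹ ^ 2) + c * ENNReal.ofReal (θ⁻¹ ^ 2)) *
            (γ * X ^ (3 / 4 : ℝ)) := by
          gcongr
          · exact hCR23 R hR
          · exact hCR R hR
      _ = 2⁻¹ * D + α₁ * X ^ (1 / 2 : ℝ) + α₂ * X ^ (3 / 4 : ℝ) := by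
          rw [quarter_add_quarter, hα₁, hα₂]; ring
      _ ≤ 2⁻¹ * D + (ε * X + K₁) + (ε * X + K₂) := by gcongr
      _ = 2⁻¹ * D + 2⁻¹ * X + K₁ + K₂ := by
          rw [hε, ← quarter_add_quarter X]; ring
      _ = (EE + D) / 2 + b := by
          rw [hX, hb, div_eq_mul_inv]; ring
  -- ### the iteration and the bound on `E` along `θᵏ r₀`
  have hiter : ∀ k : ℕ, cknE (θ ^ k * r₀) z G + cknD (θ ^ k * r₀) z p ≤ Ψ₀ := by
    intro k
    have := iterate_half_le (φ := fun ρ => cknE ρ z G + cknD ρ z p) hθ hθ1 hr₀ step k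
    refine this.trans ?_
    rw [hΨ₀]
    gcongr
    calc (2⁻¹ : ℝ≥0∞) ^ k * (cknE r₀ z G + cknD r₀ z p) ≤ 1 * (cknE r₀ z G + cknD r₀ z p) := by
          gcongr
          exact pow_le_one₀ zero_le (ENNReal.inv_le_one.2 one_le_two)
      _ = cknE r₀ z G + cknD r₀ z p := one_mul _
      _ ≤ (E₀ : ℝ≥0∞) + D₀ := add_le_add hE₀ hD₀
  -- ### `E` at every radius `0 < r ≤ r₀`
  have hEr : ∀ r ∈ Ioc (0 : ℝ) r₀, cknE r z G ≤ ENNReal.ofReal (θ⁻¹) * Ψ₀ := by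
    intro r hr
    obtain ⟨J, hJ1, hJ2⟩ := exists_nat_pow_near_of_lt_one (div_pos hr.1 hr₀)
      ((div_le_one hr₀).2 hr.2) hθ (by linarith)
    have hle : r ≤ θ ^ J * r₀ := by rwa [div_le_iff₀ hr₀] at hJ2
    have hlt : θ ^ J * r₀ < θ⁻¹ * r := by
      rw [lt_div_iff₀ hr₀] at hJ1
      have : θ ^ J * r₀ = θ⁻¹ * (θ ^ (J + 1) * r₀) := by
        rw [pow_succ]; field_simp
      rw [this]
      exact mul_lt_mul_of_pos_left hJ1 (inv_pos.2 hθ)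
    have hsub : parabolicCylinder r z ⊆ parabolicCylinder (θ ^ J * r₀) z :=
      parabolicCylinder_mono hr.1.le hle z
    calc cknE r z G ≤ ENNReal.ofReal (θ ^ J * r₀ / r) * cknE (θ ^ J * r₀) z G :=
          cknE_le_mul_of_subset (by positivity) hr.1 hsub G
      _ ≤ ENNReal.ofReal (θ⁻¹) * Ψ₀ := by
          gcongr
          · exact (div_le_iff₀ hr.1).2 hlt.le
          · exact le_self_add.trans (hiter J)
  -- ### `C` bounded on `]0, r₀]`, and the case `C`
  have hCb : ∀ r ∈ Ioc (0 : ℝ) r₀, cknC r z u ≤ (Cbar.toNNReal : ℝ≥0∞) := by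
    intro r hr
    rw [ENNReal.coe_toNNReal hCbartop, hCbar]
    refine (hCR r hr).trans ?_
    gcongr
    exact hEr r hr
  exact hK Q u p G hsw hG z r₀ hr₀ hQ hD₀ hCb

/-! ### 3. Bounded `E`, uniform constant -/

/-- **The case of a bounded dissipation, with a constant uniform in the solution and the
centre** (Seregin 2006, Lemma 2.1 (a): "Let `sup_{0<r≤1} E(r) = E₀ < +∞`. Then there exists a
positive constant `d` depending only on `E₀` such that
`A^{3/2}(r) + C(r) + D₀²(r) ≤ d(E₀)(r^{1/2}(A^{3/2}(1) + D₀²(1)) + 1)` for all `0 < r ≤ 1/4`";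
the Caffarelli–Kohn–Nirenberg quantity; boundedness only): for all `M, A₀, D₀` there is `K`
such that for every suitable weak solution `(u, p)` (unforced, `ν = 1`) on an open `Q`, every
weak spatial gradient `G` of `u` on `Q` and every backward cylinder `Q_{r₀}(z) ⊆ Q` with
`A(r₀; z) ≤ A₀`, `D(r₀; z) ≤ D₀` and `E(r; z) ≤ M` for `0 < r ≤ r₀`, one has
`A + E + C + D ≤ K` on `Q_r(z)`, `0 < r ≤ r₀/2`. The proof of `scaledEnergies_bounded_of_cknE_le`
(Seregin 2020, remark after Def. 1.7: Seregin's iteration for `𝓔 = A^{3/2} + ω D²`, Seregin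
2014, proof of Thm. 1.4, (6.1.44)–(6.1.50)), with its explicit constant written before the data.
[cite: Seregin2006, Lemma 2.1 (a) (arXiv:math/0607537 §2); Seregin2020 remark after Def. 1.7; Seregin2014 proof of Thm. 1.4 (6.1.44)–(6.1.50)] -/
theorem scaledEnergies_bounded_of_cknE_le_unif (M A₀ D₀ : ℝ≥0) :
    ∃ K : ℝ≥0, ∀ (Q : Opens (ℝ × EuclideanSpace ℝ (Fin 3)))
      (u : ℝ → EuclideanSpace ℝ (Fin 3) → EuclideanSpace ℝ (Fin 3))
      (p : ℝ → EuclideanSpace ℝ (Fin 3) → ℝ)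
      (G : ℝ → EuclideanSpace ℝ (Fin 3) → EuclideanSpace ℝ (Fin 3) →L[ℝ] EuclideanSpace ℝ (Fin 3)),
      IsSuitableWeakSolutionOn Q 1 0 u p → HasWeakSpatialGradientOn Q u G →
      ∀ (z : ℝ × EuclideanSpace ℝ (Fin 3)) (r₀ : ℝ), 0 < r₀ →
        parabolicCylinder r₀ z ⊆ (Q : Set (ℝ × EuclideanSpace ℝ (Fin 3))) →
        cknAEss r₀ z u ≤ A₀ → cknD r₀ z p ≤ D₀ → (∀ r ∈ Ioc (0 : ℝ) r₀, cknE r z G ≤ M) →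
        ∀ r ∈ Ioc (0 : ℝ) (r₀ / 2), cknAEss r z u + cknE r z G + cknC r z u + cknD r z p ≤ K := by
  -- ### the constants of the three estimates
  obtain ⟨k₁, k₂, k₃, HT⟩ := localEnergyProduct_top
  obtain ⟨C₆, hC₆⟩ := exists_cknC_le_decay
  obtain ⟨κ₇, κ₈, HP⟩ := pressureEstimateMeanZero_top
  -- ### the unit `q = 1/16` and the choice of the ratio `κ`
  set q : ℝ≥0∞ := ENNReal.ofReal (1 / 16) with hq
  have hq0 : q ≠ 0 := (ENNReal.ofReal_pos.2 (by norm_num)).ne'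
  have hqtop : q ≠ ∞ := ENNReal.ofReal_ne_top
  have h8q : 8 * q = 2⁻¹ := by
    rw [hq, ← ENNReal.ofReal_ofNat 8, ← ENNReal.ofReal_mul (by norm_num),
      show (8 : ℝ) * (1 / 16) = 2⁻¹ by norm_num, ENNReal.ofReal_inv_of_pos two_pos, ENNReal.ofReal_ofNat]
  have h2i0 : (2⁻¹ : ℝ≥0∞) ≠ 0 := ENNReal.inv_ne_zero.2 ENNReal.ofNat_ne_top
  obtain ⟨κa, hκa, Ha⟩ := exists_small_mul_rpow_le (c := 34 * (κ₈ : ℝ≥0∞) ^ 2)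
    (ENNReal.mul_ne_top ENNReal.ofNat_ne_top (ENNReal.pow_ne_top ENNReal.coe_ne_top)) h2i0 two_pos
  obtain ⟨κb, hκb, Hb⟩ := exists_small_mul_rpow_le (c := 4 * (k₁ : ℝ≥0∞) ^ (3 / 2 : ℝ) * C₆)
    (ENNReal.mul_ne_top (ENNReal.mul_ne_top ENNReal.ofNat_ne_top
      (ENNReal.rpow_ne_top_of_nonneg (by norm_num) ENNReal.coe_ne_top)) ENNReal.coe_ne_top) hq0
    (by norm_num : (0 : ℝ) < 3)
  obtain ⟨κc, hκc, Hc⟩ := exists_small_mul_rpow_le (c := 4 * (k₃ : ℝ≥0∞) ^ (3 / 2 : ℝ) * C₆)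
    (ENNReal.mul_ne_top (ENNReal.mul_ne_top ENNReal.ofNat_ne_top
      (ENNReal.rpow_ne_top_of_nonneg (by norm_num) ENNReal.coe_ne_top)) ENNReal.coe_ne_top) hq0 one_pos
  obtain ⟨κd, hκd, Hd⟩ := exists_small_mul_rpow_le
    (c := 4 * (k₂ : ℝ≥0∞) ^ (3 / 2 : ℝ) * (C₆ : ℝ≥0∞) ^ (1 / 2 : ℝ) * (M : ℝ≥0∞) ^ (3 / 4 : ℝ))
    (ENNReal.mul_ne_top (ENNReal.mul_ne_top (ENNReal.mul_ne_top ENNReal.ofNat_ne_top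
      (ENNReal.rpow_ne_top_of_nonneg (by norm_num) ENNReal.coe_ne_top))
      (ENNReal.rpow_ne_top_of_nonneg (by norm_num) ENNReal.coe_ne_top))
      (ENNReal.rpow_ne_top_of_nonneg (by norm_num) ENNReal.coe_ne_top))
    (q := 2 * q) (mul_ne_zero two_ne_zero hq0) (by norm_num : (0 : ℝ) < 3 / 4)
  set κ : ℝ := min (1 / 2) (min κa (min κb (min κc κd))) with hκdef
  have hκ0 : 0 < κ := lt_min (by norm_num) (lt_min hκa (lt_min hκb (lt_min hκc hκd)))
  have hκhalf : κ ≤ 1 / 2 := min_le_left _ _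
  have hκ1 : κ ≤ 1 := hκhalf.trans (by norm_num)
  have hκa' : κ ∈ Ioc (0 : ℝ) κa := ⟨hκ0, (min_le_right _ _).trans (min_le_left _ _)⟩
  have hκb' : κ ∈ Ioc (0 : ℝ) κb :=
    ⟨hκ0, (min_le_right _ _).trans ((min_le_right _ _).trans (min_le_left _ _))⟩
  have hκc' : κ ∈ Ioc (0 : ℝ) κc :=
    ⟨hκ0, (min_le_right _ _).trans ((min_le_right _ _).trans ((min_le_right _ _).trans (min_le_left _ _)))⟩
  have hκd' : κ ∈ Ioc (0 : ℝ) κd :=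
    ⟨hκ0, (min_le_right _ _).trans ((min_le_right _ _).trans ((min_le_right _ _).trans (min_le_right _ _)))⟩
  set X : ℝ≥0∞ := ENNReal.ofReal κ with hX
  have hX0 : X ≠ 0 := (ENNReal.ofReal_pos.2 hκ0).ne'
  have hXtop : X ≠ ∞ := ENNReal.ofReal_ne_top
  set Xi : ℝ≥0∞ := X⁻¹ with hXi
  have hXitop : Xi ≠ ∞ := ENNReal.inv_ne_top.2 hX0
  have hXieq : ENNReal.ofReal κ⁻¹ = Xi := by rw [hXi, hX, ENNReal.ofReal_inv_of_pos hκ0]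
  set Y : ℝ≥0∞ := ENNReal.ofReal ((κ ^ 2)⁻¹) with hY
  have hYtop : Y ≠ ∞ := ENNReal.ofReal_ne_top
  -- the four smallness conditions, in the forms used below
  have hXnat : ∀ n : ℕ, X ^ (n : ℝ) = X ^ n := fun n => ENNReal.rpow_natCast X n
  have Ha' : 34 * (κ₈ : ℝ≥0∞) ^ 2 * X ^ 2 ≤ 2⁻¹ := by
    have := Ha κ hκa'; rwa [show (2 : ℝ) = ((2 : ℕ) : ℝ) by norm_num, hXnat] at this
  have Hb' : 4 * (k₁ : ℝ≥0∞) ^ (3 / 2 : ℝ) * C₆ * X ^ 3 ≤ q := by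
    have := Hb κ hκb'; rwa [show (3 : ℝ) = ((3 : ℕ) : ℝ) by norm_num, hXnat] at this
  have Hc' : 4 * (k₃ : ℝ≥0∞) ^ (3 / 2 : ℝ) * C₆ * X ≤ q := by
    have := Hc κ hκc'; rwa [ENNReal.rpow_one] at this
  have Hd' : 4 * (k₂ : ℝ≥0∞) ^ (3 / 2 : ℝ) * (C₆ : ℝ≥0∞) ^ (1 / 2 : ℝ) * (M : ℝ≥0∞) ^ (3 / 4 : ℝ) *
      X ^ (3 / 4 : ℝ) ≤ 2 * q := Hd κ hκd'
  -- ### the weight `ω`, the sublinear coefficients and the absorption constants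
  set ω : ℝ≥0∞ := (4 * (k₃ : ℝ≥0∞) ^ (3 / 2 : ℝ) + 1) * X ^ 2 with hω
  have hωtop : ω ≠ ∞ := ENNReal.mul_ne_top (ENNReal.add_ne_top.2 ⟨ENNReal.mul_ne_top ENNReal.ofNat_ne_top
    (ENNReal.rpow_ne_top_of_nonneg (by norm_num) ENNReal.coe_ne_top), ENNReal.one_ne_top⟩)
    (ENNReal.pow_ne_top hXtop)
  have hk3ω : 4 * (k₃ : ℝ≥0∞) ^ (3 / 2 : ℝ) * X ^ 2 ≤ ω := by
    rw [hω]; gcongr; exact le_self_add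
  set S₁ : ℝ≥0∞ := 4 * (k₁ : ℝ≥0∞) ^ (3 / 2 : ℝ) * (C₆ * Xi ^ 3 * (M : ℝ≥0∞) ^ (3 / 4 : ℝ)) with hS₁
  set S₂ : ℝ≥0∞ := 4 * (k₃ : ℝ≥0∞) ^ (3 / 2 : ℝ) * Xi ^ 2 * (C₆ * Xi ^ 3 * (M : ℝ≥0∞) ^ (3 / 4 : ℝ)) with hS₂
  set S₃ : ℝ≥0∞ := 4 * (k₂ : ℝ≥0∞) ^ (3 / 2 : ℝ) * (Xi ^ (3 / 4 : ℝ) * (M : ℝ≥0∞) ^ (3 / 4 : ℝ)) *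
    ((C₆ : ℝ≥0∞) ^ (1 / 2 : ℝ) * Xi ^ (3 / 2 : ℝ) * (M : ℝ≥0∞) ^ (3 / 8 : ℝ)) with hS₃
  set S₄ : ℝ≥0∞ := 17 * ω * (2 * (κ₇ : ℝ≥0∞) ^ 2 * Y ^ 2 * (M : ℝ≥0∞) ^ 2) with hS₄
  have hMt : ∀ e : ℝ, 0 ≤ e → (M : ℝ≥0∞) ^ e ≠ ∞ := fun e he => ENNReal.rpow_ne_top_of_nonneg he ENNReal.coe_ne_top
  have hXit : ∀ e : ℝ, 0 ≤ e → Xi ^ e ≠ ∞ := fun e he => ENNReal.rpow_ne_top_of_nonneg he hXitop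
  have hS₁top : S₁ ≠ ∞ := ENNReal.mul_ne_top (ENNReal.mul_ne_top ENNReal.ofNat_ne_top
    (ENNReal.rpow_ne_top_of_nonneg (by norm_num) ENNReal.coe_ne_top))
    (ENNReal.mul_ne_top (ENNReal.mul_ne_top ENNReal.coe_ne_top (ENNReal.pow_ne_top hXitop)) (hMt _ (by norm_num)))
  have hS₂top : S₂ ≠ ∞ := ENNReal.mul_ne_top (ENNReal.mul_ne_top (ENNReal.mul_ne_top ENNReal.ofNat_ne_top
    (ENNReal.rpow_ne_top_of_nonneg (by norm_num) ENNReal.coe_ne_top)) (ENNReal.pow_ne_top hXitop))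
    (ENNReal.mul_ne_top (ENNReal.mul_ne_top ENNReal.coe_ne_top (ENNReal.pow_ne_top hXitop)) (hMt _ (by norm_num)))
  have hS₃top : S₃ ≠ ∞ := ENNReal.mul_ne_top (ENNReal.mul_ne_top (ENNReal.mul_ne_top ENNReal.ofNat_ne_top
    (ENNReal.rpow_ne_top_of_nonneg (by norm_num) ENNReal.coe_ne_top))
    (ENNReal.mul_ne_top (hXit _ (by norm_num)) (hMt _ (by norm_num))))
    (ENNReal.mul_ne_top (ENNReal.mul_ne_top (ENNReal.rpow_ne_top_of_nonneg (by norm_num) ENNReal.coe_ne_top)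
      (hXit _ (by norm_num))) (hMt _ (by norm_num)))
  have hS₄top : S₄ ≠ ∞ := ENNReal.mul_ne_top (ENNReal.mul_ne_top ENNReal.ofNat_ne_top hωtop)
    (ENNReal.mul_ne_top (ENNReal.mul_ne_top (ENNReal.mul_ne_top ENNReal.ofNat_ne_top
      (ENNReal.pow_ne_top ENNReal.coe_ne_top)) (ENNReal.pow_ne_top hYtop)) (ENNReal.pow_ne_top ENNReal.coe_ne_top))
  have hqi : q⁻¹ ≠ ∞ := ENNReal.inv_ne_top.2 hq0
  set K₁ : ℝ≥0∞ := (S₁ * q⁻¹ ^ (1 / 2 : ℝ)) ^ (1 / (1 - 1 / 2 : ℝ)) with hK₁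
  set K₂ : ℝ≥0∞ := (S₂ * q⁻¹ ^ (1 / 2 : ℝ)) ^ (1 / (1 - 1 / 2 : ℝ)) with hK₂
  set K₃ : ℝ≥0∞ := (S₃ * q⁻¹ ^ (3 / 4 : ℝ)) ^ (1 / (1 - 3 / 4 : ℝ)) with hK₃
  set K₄ : ℝ≥0∞ := (S₄ * q⁻¹ ^ (2 / 3 : ℝ)) ^ (1 / (1 - 2 / 3 : ℝ)) with hK₄
  have hKtop : ∀ {S : ℝ≥0∞} {e d : ℝ}, S ≠ ∞ → 0 ≤ e → 0 ≤ d → (S * q⁻¹ ^ e) ^ d ≠ ∞ := fun hS he hd =>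
    ENNReal.rpow_ne_top_of_nonneg hd (ENNReal.mul_ne_top hS (ENNReal.rpow_ne_top_of_nonneg he hqi))
  set b : ℝ≥0∞ := K₁ + K₂ + K₃ + K₄ with hb
  have hbtop : b ≠ ∞ := ENNReal.add_ne_top.2 ⟨ENNReal.add_ne_top.2 ⟨ENNReal.add_ne_top.2
    ⟨hKtop hS₁top (by norm_num) (by norm_num), hKtop hS₂top (by norm_num) (by norm_num)⟩,
    hKtop hS₃top (by norm_num) (by norm_num)⟩, hKtop hS₄top (by norm_num) (by norm_num)⟩
  -- ### the level reached by the iteration and the resulting bound on `A`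
  set Φ₀ : ℝ≥0∞ := 2 * b + ((A₀ : ℝ≥0∞) ^ (3 / 2 : ℝ) + ω * (D₀ : ℝ≥0∞) ^ 2) with hΦ₀
  have hΦ₀top : Φ₀ ≠ ∞ := ENNReal.add_ne_top.2 ⟨ENNReal.mul_ne_top ENNReal.ofNat_ne_top hbtop,
    ENNReal.add_ne_top.2 ⟨ENNReal.rpow_ne_top_of_nonneg (by norm_num) ENNReal.coe_ne_top,
      ENNReal.mul_ne_top hωtop (ENNReal.pow_ne_top ENNReal.coe_ne_top)⟩⟩
  set Abar : ℝ≥0∞ := ENNReal.ofReal ((κ / 2)⁻¹) * Φ₀ ^ (2 / 3 : ℝ) with hAbar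
  have hAbartop : Abar ≠ ∞ := ENNReal.mul_ne_top ENNReal.ofReal_ne_top (ENNReal.rpow_ne_top_of_nonneg (by norm_num) hΦ₀top)
  -- the constant of the case `A`
  obtain ⟨K, hK⟩ := scaledEnergies_bounded_of_cknAEss_le_unif Abar.toNNReal M D₀
  refine ⟨K, fun Q u p G hsw hG z r₀ hr₀ hQ hA₀ hD₀ hM => ?_⟩
  have hA₀' : cknAEss r₀ z u ≠ ∞ := ne_top_of_le_ne_top ENNReal.coe_ne_top hA₀
  -- ### finiteness of `A` below `r₀`
  have hAfin : ∀ ϱ ∈ Ioc (0 : ℝ) r₀, cknAEss ϱ z u ≠ ∞ := fun ϱ hϱ =>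
    ne_top_of_le_ne_top (ENNReal.mul_ne_top ENNReal.ofReal_ne_top hA₀')
      (cknAEss_le_mul_of_subset hr₀ hϱ.1 (Ioo_subset_Ioo (by nlinarith [hϱ.1, hϱ.2]) le_rfl)
        (ball_subset_ball hϱ.2) u)
  -- ### the one-step inequality for `Φ = A^{3/2} + ω D²`
  have step : ∀ ϱ, 0 < ϱ → ϱ ≤ r₀ →
      cknAEss (κ / 2 * ϱ) z u ^ (3 / 2 : ℝ) + ω * cknD (κ / 2 * ϱ) z p ^ 2 ≤
        (cknAEss ϱ z u ^ (3 / 2 : ℝ) + ω * cknD ϱ z p ^ 2) / 2 + b := by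
    intro ϱ hϱ0 hϱr₀
    have hϱ : ϱ ∈ Ioc (0 : ℝ) r₀ := ⟨hϱ0, hϱr₀⟩
    have hQϱ : parabolicCylinder ϱ z ⊆ (Q : Set (ℝ × EuclideanSpace ℝ (Fin 3))) :=
      (parabolicCylinder_mono hϱ0.le hϱr₀ z).trans hQ
    set a := cknAEss ϱ z u with hadef
    set d := cknD ϱ z p with hddef
    set 𝓐 := a ^ (3 / 2 : ℝ) with h𝓐
    have hatop : a ≠ ∞ := hAfin ϱ hϱ
    have hEϱ : cknE ϱ z G ≤ M := hM ϱ hϱ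
    have hEϱtop : cknE ϱ z G ≠ ∞ := ne_top_of_le_ne_top ENNReal.coe_ne_top hEϱ
    -- powers of `a` as powers of `𝓐`
    have ha34 : a ^ (3 / 4 : ℝ) = 𝓐 ^ (1 / 2 : ℝ) := by rw [h𝓐, ← ENNReal.rpow_mul]; norm_num
    have ha12 : a ^ (1 / 2 : ℝ) = 𝓐 ^ (1 / 3 : ℝ) := by rw [h𝓐, ← ENNReal.rpow_mul]; norm_num
    have ha1 : a = 𝓐 ^ (2 / 3 : ℝ) := by rw [h𝓐, ← ENNReal.rpow_mul]; norm_num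
    -- the small cylinder `R = κϱ`
    set R := κ * ϱ with hRdef
    have hR : 0 < R := mul_pos hκ0 hϱ0
    have hRϱ : R ≤ ϱ := by rw [hRdef]; nlinarith
    have hRr₀ : R ≤ r₀ := hRϱ.trans hϱr₀
    have hQR : parabolicCylinder R z ⊆ (Q : Set (ℝ × EuclideanSpace ℝ (Fin 3))) :=
      (parabolicCylinder_mono hR.le hRϱ z).trans hQϱ
    have hsubR : parabolicCylinder R z ⊆ parabolicCylinder ϱ z := parabolicCylinder_mono hR.le hRϱ z
    -- (1) the cubic quantity by the decay interpolation
    have hC : cknC R z u ≤ C₆ * (X ^ 3 * 𝓐) + C₆ * (Xi ^ 3 * (M : ℝ≥0∞) ^ (3 / 4 : ℝ)) * 𝓐 ^ (1 / 2 : ℝ) := by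
      have hGϱ : HasWeakSpatialGradientOn (parabolicCylinderOpens ϱ z) u G := hG.mono (fun w hw => hQϱ hw)
      have key := hC₆ u G z ϱ R hR hRϱ hGϱ hatop hEϱtop
      have e1 : R / ϱ = κ := by rw [hRdef]; field_simp
      have e2 : ϱ / R = κ⁻¹ := by rw [hRdef]; field_simp
      rw [e1, e2, hXieq] at key
      calc cknC R z u ≤ C₆ * (X ^ 3 * a ^ (3 / 2 : ℝ) + Xi ^ 3 * a ^ (3 / 4 : ℝ) * cknE ϱ z G ^ (3 / 4 : ℝ)) := key
        _ ≤ C₆ * (X ^ 3 * a ^ (3 / 2 : ℝ) + Xi ^ 3 * a ^ (3 / 4 : ℝ) * (M : ℝ≥0∞) ^ (3 / 4 : ℝ)) := by gcongr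
        _ = _ := by rw [ha34, h𝓐]; ring
    have hChalf : cknC R z u ^ (1 / 2 : ℝ) ≤ (C₆ : ℝ≥0∞) ^ (1 / 2 : ℝ) * X ^ (3 / 2 : ℝ) * 𝓐 ^ (1 / 2 : ℝ) +
        (C₆ : ℝ≥0∞) ^ (1 / 2 : ℝ) * Xi ^ (3 / 2 : ℝ) * (M : ℝ≥0∞) ^ (3 / 8 : ℝ) * 𝓐 ^ (1 / 4 : ℝ) := by
      refine (ENNReal.rpow_le_rpow hC (by norm_num)).trans ?_
      refine (ENNReal.rpow_add_le_add_rpow _ _ (by norm_num) (by norm_num)).trans (le_of_eq ?_)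
      have hX3 : (X ^ 3 : ℝ≥0∞) = X ^ (3 : ℝ) := by rw [← ENNReal.rpow_natCast]; norm_num
      have hXi3 : (Xi ^ 3 : ℝ≥0∞) = Xi ^ (3 : ℝ) := by rw [← ENNReal.rpow_natCast]; norm_num
      rw [hX3, hXi3]
      simp only [ENNReal.mul_rpow_of_nonneg _ _ (show (0 : ℝ) ≤ 1 / 2 by norm_num), ← ENNReal.rpow_mul]
      norm_num
      ring
    -- (2) energy and dissipation of the small cylinder
    have hAR : cknAEss R z u ≤ Xi * a := by
      have hI : Ioo (z.1 - R ^ 2) z.1 ⊆ Ioo (z.1 - ϱ ^ 2) z.1 :=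
        Ioo_subset_Ioo (by linarith [pow_le_pow_left₀ hR.le hRϱ 2]) le_rfl
      have := cknAEss_le_mul_of_subset (z := z) (z' := z) hϱ0 hR hI (ball_subset_ball hRϱ) u
      have e2 : ϱ / R = κ⁻¹ := by rw [hRdef]; field_simp
      rwa [e2, hXieq] at this
    have hER : cknE R z G ≤ M := hM R ⟨hR, hRr₀⟩
    have hAE : (cknAEss R z u * cknE R z G) ^ (3 / 4 : ℝ) ≤ Xi ^ (3 / 4 : ℝ) * (M : ℝ≥0∞) ^ (3 / 4 : ℝ) * 𝓐 ^ (1 / 2 : ℝ) := by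
      calc (cknAEss R z u * cknE R z G) ^ (3 / 4 : ℝ) ≤ (Xi * a * M) ^ (3 / 4 : ℝ) := by gcongr
        _ = _ := by
            rw [ENNReal.mul_rpow_of_nonneg _ _ (by norm_num : (0 : ℝ) ≤ 3 / 4),
              ENNReal.mul_rpow_of_nonneg Xi a (by norm_num : (0 : ℝ) ≤ 3 / 4), ha34]
            ring
    -- (3) the pressure of the small cylinder
    have hDR : cknD R z p ≤ κ₇ * Y * (M : ℝ≥0∞) * 𝓐 ^ (1 / 3 : ℝ) + κ₈ * X * d := by
      have key := HP Q u p G hsw hG z ϱ κ hϱ0 hκ0 hκhalf hQϱ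
      calc cknD R z p = cknD (κ * ϱ) z p := rfl
        _ ≤ κ₇ * Y * a ^ (1 / 2 : ℝ) * cknE ϱ z G + κ₈ * X * d := key
        _ ≤ κ₇ * Y * a ^ (1 / 2 : ℝ) * M + κ₈ * X * d := by gcongr
        _ = _ := by rw [ha12]; ring
    have hDsq : cknD R z p ^ 2 ≤ 2 * ((κ₇ : ℝ≥0∞) ^ 2 * Y ^ 2 * (M : ℝ≥0∞) ^ 2) * 𝓐 ^ (2 / 3 : ℝ) +
        2 * ((κ₈ : ℝ≥0∞) ^ 2 * X ^ 2) * d ^ 2 := by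
      refine (pow_le_pow_left' hDR 2).trans ((PoincareBall.add_sq_le_two_mul_sq_add _ _).trans (le_of_eq ?_))
      rw [mul_pow, mul_pow, mul_pow, mul_pow, mul_pow, ← ENNReal.rpow_natCast (𝓐 ^ (1 / 3 : ℝ)) 2,
        ← ENNReal.rpow_mul]
      norm_num
      ring
    -- (4) the energy at `R/2` by the product-form local energy estimate
    have hT8 : cknAEss (R / 2) z u ≤ k₁ * cknC R z u ^ (2 / 3 : ℝ) +
        k₂ * ((cknAEss R z u * cknE R z G) ^ (1 / 2 : ℝ) * cknC R z u ^ (1 / 3 : ℝ)) +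
        k₃ * (cknD R z p ^ (2 / 3 : ℝ) * cknC R z u ^ (1 / 3 : ℝ)) :=
      le_self_add.trans (HT Q u p G hsw hG z R hR hQR)
    -- (5) the pressure at `R/2` by monotonicity
    have hDhalf : cknD (R / 2) z p ≤ 4 * cknD R z p := by
      have := cknD_le_mul_of_subset hR (half_pos hR) (parabolicCylinder_mono (half_pos hR).le (by linarith) z) p
      have e4 : ENNReal.ofReal (R / (R / 2)) ^ 2 = 4 := by
        rw [show R / (R / 2) = 2 by field_simp, ENNReal.ofReal_ofNat]; norm_num
      rwa [e4] at this
    -- ### assembling the step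
    have hγ : κ / 2 * ϱ = R / 2 := by rw [hRdef]; ring
    rw [hγ]
    set C := cknC R z u with hCdef
    set AR := cknAEss R z u with hARdef
    set ER := cknE R z G with hERdef
    set DR := cknD R z p with hDRdef
    -- stage 1
    have hA32 : cknAEss (R / 2) z u ^ (3 / 2 : ℝ) ≤ 4 * ((k₁ : ℝ≥0∞) ^ (3 / 2 : ℝ) * C +
        (k₂ : ℝ≥0∞) ^ (3 / 2 : ℝ) * ((AR * ER) ^ (3 / 4 : ℝ) * C ^ (1 / 2 : ℝ)) +
        (k₃ : ℝ≥0∞) ^ (3 / 2 : ℝ) * (DR * C ^ (1 / 2 : ℝ))) := by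
      refine (ENNReal.rpow_le_rpow hT8 (by norm_num)).trans ((RRS2016.ennreal_add_three_rpow_threeHalves_le _ _ _).trans (le_of_eq ?_))
      congr 1
      simp only [ENNReal.mul_rpow_of_nonneg _ _ (show (0 : ℝ) ≤ 3 / 2 by norm_num), ← ENNReal.rpow_mul]
      norm_num
    have hD2 : ω * cknD (R / 2) z p ^ 2 ≤ 16 * ω * DR ^ 2 := by
      calc ω * cknD (R / 2) z p ^ 2 ≤ ω * (4 * DR) ^ 2 := by gcongr
        _ = 16 * ω * DR ^ 2 := by ring
    -- stage 2: Young on the mixed pressure term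
    have hYoung : 4 * ((k₃ : ℝ≥0∞) ^ (3 / 2 : ℝ) * (DR * C ^ (1 / 2 : ℝ))) ≤ ω * DR ^ 2 +
        4 * (k₃ : ℝ≥0∞) ^ (3 / 2 : ℝ) * Xi ^ 2 * C := by
      calc 4 * ((k₃ : ℝ≥0∞) ^ (3 / 2 : ℝ) * (DR * C ^ (1 / 2 : ℝ)))
          ≤ 4 * ((k₃ : ℝ≥0∞) ^ (3 / 2 : ℝ) * (X ^ 2 * DR ^ 2 + X⁻¹ ^ 2 * C)) := by
            gcongr; exact mul_rpow_half_le_weighted DR C hX0 hXtop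
        _ = (4 * (k₃ : ℝ≥0∞) ^ (3 / 2 : ℝ) * X ^ 2) * DR ^ 2 + 4 * (k₃ : ℝ≥0∞) ^ (3 / 2 : ℝ) * Xi ^ 2 * C := by
            rw [hXi]; ring
        _ ≤ ω * DR ^ 2 + 4 * (k₃ : ℝ≥0∞) ^ (3 / 2 : ℝ) * Xi ^ 2 * C := by gcongr
    have stage2 : cknAEss (R / 2) z u ^ (3 / 2 : ℝ) + ω * cknD (R / 2) z p ^ 2 ≤
        (4 * (k₁ : ℝ≥0∞) ^ (3 / 2 : ℝ) + 4 * (k₃ : ℝ≥0∞) ^ (3 / 2 : ℝ) * Xi ^ 2) * C +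
        4 * (k₂ : ℝ≥0∞) ^ (3 / 2 : ℝ) * ((AR * ER) ^ (3 / 4 : ℝ) * C ^ (1 / 2 : ℝ)) + 17 * ω * DR ^ 2 := by
      calc cknAEss (R / 2) z u ^ (3 / 2 : ℝ) + ω * cknD (R / 2) z p ^ 2
          ≤ 4 * ((k₁ : ℝ≥0∞) ^ (3 / 2 : ℝ) * C + (k₂ : ℝ≥0∞) ^ (3 / 2 : ℝ) * ((AR * ER) ^ (3 / 4 : ℝ) * C ^ (1 / 2 : ℝ)) +
              (k₃ : ℝ≥0∞) ^ (3 / 2 : ℝ) * (DR * C ^ (1 / 2 : ℝ))) + 16 * ω * DR ^ 2 := add_le_add hA32 hD2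
        _ = 4 * (k₁ : ℝ≥0∞) ^ (3 / 2 : ℝ) * C + 4 * (k₂ : ℝ≥0∞) ^ (3 / 2 : ℝ) * ((AR * ER) ^ (3 / 4 : ℝ) * C ^ (1 / 2 : ℝ)) +
            4 * ((k₃ : ℝ≥0∞) ^ (3 / 2 : ℝ) * (DR * C ^ (1 / 2 : ℝ))) + 16 * ω * DR ^ 2 := by ring
        _ ≤ 4 * (k₁ : ℝ≥0∞) ^ (3 / 2 : ℝ) * C + 4 * (k₂ : ℝ≥0∞) ^ (3 / 2 : ℝ) * ((AR * ER) ^ (3 / 4 : ℝ) * C ^ (1 / 2 : ℝ)) +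
            (ω * DR ^ 2 + 4 * (k₃ : ℝ≥0∞) ^ (3 / 2 : ℝ) * Xi ^ 2 * C) + 16 * ω * DR ^ 2 := by gcongr
        _ = _ := by ring
    -- stage 3: substitute the bounds (1)–(3)
    have hlinI : (4 * (k₁ : ℝ≥0∞) ^ (3 / 2 : ℝ)) * (C₆ * (X ^ 3 * 𝓐)) ≤ q * 𝓐 := by
      calc (4 * (k₁ : ℝ≥0∞) ^ (3 / 2 : ℝ)) * (C₆ * (X ^ 3 * 𝓐)) = (4 * (k₁ : ℝ≥0∞) ^ (3 / 2 : ℝ) * C₆ * X ^ 3) * 𝓐 := by ring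
        _ ≤ q * 𝓐 := mul_le_mul_left Hb' _
    have hlinIII : (4 * (k₃ : ℝ≥0∞) ^ (3 / 2 : ℝ) * Xi ^ 2) * (C₆ * (X ^ 3 * 𝓐)) ≤ q * 𝓐 := by
      calc (4 * (k₃ : ℝ≥0∞) ^ (3 / 2 : ℝ) * Xi ^ 2) * (C₆ * (X ^ 3 * 𝓐))
          = (4 * (k₃ : ℝ≥0∞) ^ (3 / 2 : ℝ) * C₆ * (Xi ^ 2 * X ^ 3)) * 𝓐 := by ring
        _ = (4 * (k₃ : ℝ≥0∞) ^ (3 / 2 : ℝ) * C₆ * X) * 𝓐 := by rw [hXi, inv_sq_mul_cube hX0 hXtop]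
        _ ≤ q * 𝓐 := mul_le_mul_left Hc' _
    have hlinII : 4 * (k₂ : ℝ≥0∞) ^ (3 / 2 : ℝ) * (Xi ^ (3 / 4 : ℝ) * (M : ℝ≥0∞) ^ (3 / 4 : ℝ) * 𝓐 ^ (1 / 2 : ℝ)) *
        ((C₆ : ℝ≥0∞) ^ (1 / 2 : ℝ) * X ^ (3 / 2 : ℝ) * 𝓐 ^ (1 / 2 : ℝ)) ≤ 2 * q * 𝓐 := by
      calc 4 * (k₂ : ℝ≥0∞) ^ (3 / 2 : ℝ) * (Xi ^ (3 / 4 : ℝ) * (M : ℝ≥0∞) ^ (3 / 4 : ℝ) * 𝓐 ^ (1 / 2 : ℝ)) *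
            ((C₆ : ℝ≥0∞) ^ (1 / 2 : ℝ) * X ^ (3 / 2 : ℝ) * 𝓐 ^ (1 / 2 : ℝ))
          = (4 * (k₂ : ℝ≥0∞) ^ (3 / 2 : ℝ) * (C₆ : ℝ≥0∞) ^ (1 / 2 : ℝ) * (M : ℝ≥0∞) ^ (3 / 4 : ℝ) *
              (Xi ^ (3 / 4 : ℝ) * X ^ (3 / 2 : ℝ))) * (𝓐 ^ (1 / 2 : ℝ) * 𝓐 ^ (1 / 2 : ℝ)) := by ring
        _ = (4 * (k₂ : ℝ≥0∞) ^ (3 / 2 : ℝ) * (C₆ : ℝ≥0∞) ^ (1 / 2 : ℝ) * (M : ℝ≥0∞) ^ (3 / 4 : ℝ) * X ^ (3 / 4 : ℝ)) * 𝓐 := by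
            rw [hXi, inv_rpow_mul_rpow_threeHalves hX0 hXtop, ← ENNReal.rpow_add_of_nonneg _ _ (by norm_num) (by norm_num)]
            norm_num
        _ ≤ 2 * q * 𝓐 := mul_le_mul_left Hd' _
    have hsubII : 4 * (k₂ : ℝ≥0∞) ^ (3 / 2 : ℝ) * (Xi ^ (3 / 4 : ℝ) * (M : ℝ≥0∞) ^ (3 / 4 : ℝ) * 𝓐 ^ (1 / 2 : ℝ)) *
        ((C₆ : ℝ≥0∞) ^ (1 / 2 : ℝ) * Xi ^ (3 / 2 : ℝ) * (M : ℝ≥0∞) ^ (3 / 8 : ℝ) * 𝓐 ^ (1 / 4 : ℝ)) = S₃ * 𝓐 ^ (3 / 4 : ℝ) := by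
      rw [hS₃]
      calc _ = 4 * (k₂ : ℝ≥0∞) ^ (3 / 2 : ℝ) * (Xi ^ (3 / 4 : ℝ) * (M : ℝ≥0∞) ^ (3 / 4 : ℝ)) *
            ((C₆ : ℝ≥0∞) ^ (1 / 2 : ℝ) * Xi ^ (3 / 2 : ℝ) * (M : ℝ≥0∞) ^ (3 / 8 : ℝ)) * (𝓐 ^ (1 / 2 : ℝ) * 𝓐 ^ (1 / 4 : ℝ)) := by ring
        _ = _ := by rw [← ENNReal.rpow_add_of_nonneg _ _ (by norm_num) (by norm_num)]; norm_num
    have hdcoef : 17 * ω * (2 * ((κ₈ : ℝ≥0∞) ^ 2 * X ^ 2) * d ^ 2) ≤ 2⁻¹ * (ω * d ^ 2) := by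
      calc 17 * ω * (2 * ((κ₈ : ℝ≥0∞) ^ 2 * X ^ 2) * d ^ 2) = (34 * (κ₈ : ℝ≥0∞) ^ 2 * X ^ 2) * (ω * d ^ 2) := by ring
        _ ≤ 2⁻¹ * (ω * d ^ 2) := mul_le_mul_left Ha' _
    -- absorption of the four sublinear terms
    have hab1 : S₁ * 𝓐 ^ (1 / 2 : ℝ) ≤ q * 𝓐 + K₁ := rpow_le_mul_add (by norm_num) (by norm_num) S₁ 𝓐 hq0 hqtop
    have hab2 : S₂ * 𝓐 ^ (1 / 2 : ℝ) ≤ q * 𝓐 + K₂ := rpow_le_mul_add (by norm_num) (by norm_num) S₂ 𝓐 hq0 hqtop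
    have hab3 : S₃ * 𝓐 ^ (3 / 4 : ℝ) ≤ q * 𝓐 + K₃ := rpow_le_mul_add (by norm_num) (by norm_num) S₃ 𝓐 hq0 hqtop
    have hab4 : S₄ * 𝓐 ^ (2 / 3 : ℝ) ≤ q * 𝓐 + K₄ := rpow_le_mul_add (by norm_num) (by norm_num) S₄ 𝓐 hq0 hqtop
    calc cknAEss (R / 2) z u ^ (3 / 2 : ℝ) + ω * cknD (R / 2) z p ^ 2
        ≤ (4 * (k₁ : ℝ≥0∞) ^ (3 / 2 : ℝ) + 4 * (k₃ : ℝ≥0∞) ^ (3 / 2 : ℝ) * Xi ^ 2) * C +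
          4 * (k₂ : ℝ≥0∞) ^ (3 / 2 : ℝ) * ((AR * ER) ^ (3 / 4 : ℝ) * C ^ (1 / 2 : ℝ)) + 17 * ω * DR ^ 2 := stage2
      _ ≤ (4 * (k₁ : ℝ≥0∞) ^ (3 / 2 : ℝ) + 4 * (k₃ : ℝ≥0∞) ^ (3 / 2 : ℝ) * Xi ^ 2) *
            (C₆ * (X ^ 3 * 𝓐) + C₆ * (Xi ^ 3 * (M : ℝ≥0∞) ^ (3 / 4 : ℝ)) * 𝓐 ^ (1 / 2 : ℝ)) +
          4 * (k₂ : ℝ≥0∞) ^ (3 / 2 : ℝ) * ((Xi ^ (3 / 4 : ℝ) * (M : ℝ≥0∞) ^ (3 / 4 : ℝ) * 𝓐 ^ (1 / 2 : ℝ)) *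
            ((C₆ : ℝ≥0∞) ^ (1 / 2 : ℝ) * X ^ (3 / 2 : ℝ) * 𝓐 ^ (1 / 2 : ℝ) +
              (C₆ : ℝ≥0∞) ^ (1 / 2 : ℝ) * Xi ^ (3 / 2 : ℝ) * (M : ℝ≥0∞) ^ (3 / 8 : ℝ) * 𝓐 ^ (1 / 4 : ℝ))) +
          17 * ω * (2 * ((κ₇ : ℝ≥0∞) ^ 2 * Y ^ 2 * (M : ℝ≥0∞) ^ 2) * 𝓐 ^ (2 / 3 : ℝ) +
            2 * ((κ₈ : ℝ≥0∞) ^ 2 * X ^ 2) * d ^ 2) := by gcongr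
      _ = (4 * (k₁ : ℝ≥0∞) ^ (3 / 2 : ℝ)) * (C₆ * (X ^ 3 * 𝓐)) +
          (4 * (k₃ : ℝ≥0∞) ^ (3 / 2 : ℝ) * Xi ^ 2) * (C₆ * (X ^ 3 * 𝓐)) +
          S₁ * 𝓐 ^ (1 / 2 : ℝ) + S₂ * 𝓐 ^ (1 / 2 : ℝ) +
          4 * (k₂ : ℝ≥0∞) ^ (3 / 2 : ℝ) * (Xi ^ (3 / 4 : ℝ) * (M : ℝ≥0∞) ^ (3 / 4 : ℝ) * 𝓐 ^ (1 / 2 : ℝ)) *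
            ((C₆ : ℝ≥0∞) ^ (1 / 2 : ℝ) * X ^ (3 / 2 : ℝ) * 𝓐 ^ (1 / 2 : ℝ)) +
          4 * (k₂ : ℝ≥0∞) ^ (3 / 2 : ℝ) * (Xi ^ (3 / 4 : ℝ) * (M : ℝ≥0∞) ^ (3 / 4 : ℝ) * 𝓐 ^ (1 / 2 : ℝ)) *
            ((C₆ : ℝ≥0∞) ^ (1 / 2 : ℝ) * Xi ^ (3 / 2 : ℝ) * (M : ℝ≥0∞) ^ (3 / 8 : ℝ) * 𝓐 ^ (1 / 4 : ℝ)) +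
          S₄ * 𝓐 ^ (2 / 3 : ℝ) + 17 * ω * (2 * ((κ₈ : ℝ≥0∞) ^ 2 * X ^ 2) * d ^ 2) := by
          rw [hS₁, hS₂, hS₄]; ring
      _ ≤ q * 𝓐 + q * 𝓐 + (q * 𝓐 + K₁) + (q * 𝓐 + K₂) + 2 * q * 𝓐 + (q * 𝓐 + K₃) + (q * 𝓐 + K₄) +
          2⁻¹ * (ω * d ^ 2) := by
          rw [hsubII]
          exact add_le_add (add_le_add (add_le_add (add_le_add (add_le_add (add_le_add (add_le_add hlinI hlinIII)
            hab1) hab2) hlinII) hab3) hab4) hdcoef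
      _ = (8 * q) * 𝓐 + 2⁻¹ * (ω * d ^ 2) + b := by rw [hb]; ring
      _ = (𝓐 + ω * d ^ 2) / 2 + b := by rw [h8q, div_eq_mul_inv]; ring
  -- ### the iteration and the bound on `A` along `γᵏ r₀`, `γ = κ/2`
  have hγ0 : 0 < κ / 2 := half_pos hκ0
  have hγ1 : κ / 2 ≤ 1 := by linarith
  have hiter : ∀ k : ℕ, cknAEss ((κ / 2) ^ k * r₀) z u ^ (3 / 2 : ℝ) ≤ Φ₀ := by
    intro k
    have := iterate_half_le (φ := fun ρ => cknAEss ρ z u ^ (3 / 2 : ℝ) + ω * cknD ρ z p ^ 2) hγ0 hγ1 hr₀ step k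
    refine le_self_add.trans (this.trans ?_)
    rw [hΦ₀]
    gcongr
    calc (2⁻¹ : ℝ≥0∞) ^ k * (cknAEss r₀ z u ^ (3 / 2 : ℝ) + ω * cknD r₀ z p ^ 2)
        ≤ 1 * (cknAEss r₀ z u ^ (3 / 2 : ℝ) + ω * cknD r₀ z p ^ 2) := by
          gcongr
          exact pow_le_one₀ zero_le (ENNReal.inv_le_one.2 one_le_two)
      _ = cknAEss r₀ z u ^ (3 / 2 : ℝ) + ω * cknD r₀ z p ^ 2 := one_mul _
      _ ≤ (A₀ : ℝ≥0∞) ^ (3 / 2 : ℝ) + ω * (D₀ : ℝ≥0∞) ^ 2 := by gcongr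
  -- ### `A` at every radius `0 < r ≤ r₀`
  have hAr : ∀ r ∈ Ioc (0 : ℝ) r₀, cknAEss r z u ≤ Abar := by
    intro r hr
    obtain ⟨J, hJ1, hJ2⟩ := exists_nat_pow_near_of_lt_one (div_pos hr.1 hr₀)
      ((div_le_one hr₀).2 hr.2) hγ0 (by linarith)
    have hle : r ≤ (κ / 2) ^ J * r₀ := by rwa [div_le_iff₀ hr₀] at hJ2
    have hpos : 0 < (κ / 2) ^ J * r₀ := by positivity
    have hlt : (κ / 2) ^ J * r₀ < (κ / 2)⁻¹ * r := by
      rw [lt_div_iff₀ hr₀] at hJ1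
      have : (κ / 2) ^ J * r₀ = (κ / 2)⁻¹ * ((κ / 2) ^ (J + 1) * r₀) := by
        rw [pow_succ]; field_simp
      rw [this]
      exact mul_lt_mul_of_pos_left hJ1 (inv_pos.2 hγ0)
    have hI : Ioo (z.1 - r ^ 2) z.1 ⊆ Ioo (z.1 - ((κ / 2) ^ J * r₀) ^ 2) z.1 :=
      Ioo_subset_Ioo (by linarith [pow_le_pow_left₀ hr.1.le hle 2]) le_rfl
    have hA32 : cknAEss ((κ / 2) ^ J * r₀) z u ≤ Φ₀ ^ (2 / 3 : ℝ) := by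
      have := ENNReal.rpow_le_rpow (hiter J) (by norm_num : (0 : ℝ) ≤ 2 / 3)
      rwa [← ENNReal.rpow_mul, show (3 / 2 : ℝ) * (2 / 3) = 1 by norm_num, ENNReal.rpow_one] at this
    calc cknAEss r z u ≤ ENNReal.ofReal ((κ / 2) ^ J * r₀ / r) * cknAEss ((κ / 2) ^ J * r₀) z u :=
          cknAEss_le_mul_of_subset (z := z) (z' := z) hpos hr.1 hI (ball_subset_ball hle) u
      _ ≤ ENNReal.ofReal ((κ / 2)⁻¹) * Φ₀ ^ (2 / 3 : ℝ) := by
          gcongr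
          exact (div_le_iff₀ hr.1).2 hlt.le
  -- ### the case `A`
  have hAb : ∀ r ∈ Ioc (0 : ℝ) r₀, cknAEss r z u ≤ (Abar.toNNReal : ℝ≥0∞) := fun r hr => by
    rw [ENNReal.coe_toNNReal hAbartop]; exact hAr r hr
  exact hK Q u p G hsw hG z r₀ hr₀ hQ (hM r₀ ⟨hr₀, le_rfl⟩) hD₀ hAb

end Seregin2020


/-! ### 4. Albritton–Barker's Lemma 2.6: the covering bookkeeping -/

section Assembly

/-- **The mean-free pressure quantity is dominated by the plain one**:
`D_osc(Q(z, r)) = r⁻² ∫_{Q(z,r)} |q - [q]_{x,r}|^{3/2} ≤ 4 r⁻² ∫_{Q(z,r)} |q|^{3/2} = 4 D(Q(z, r))`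
(`|a - b|^{3/2} ≤ √2 (|a|^{3/2} + |b|^{3/2})` and Jensen `∫_B |[q]_B|^{3/2} ≤ ∫_B |q|^{3/2}` on
each time slice; `2√2 ≤ 4`). [folklore] -/
theorem cknDOsc_le_mul_cknD {r : ℝ} (hr : 0 < r) (z : ℝ × EuclideanSpace ℝ (Fin 3)) {p : ℝ → EuclideanSpace ℝ (Fin 3) → ℝ}
    (hp : AEStronglyMeasurable (uncurry p) (volume.restrict (parabolicCylinder r z))) :
    cknDOsc r z p ≤ 4 * cknD r z p := by
  have hB0 : volume (ball z.2 r) ≠ 0 := (measure_ball_pos volume z.2 hr).ne'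
  have hBtop : volume (ball z.2 r) ≠ ∞ := measure_ball_lt_top.ne
  have hQ : parabolicCylinder r z = Ioo (z.1 - r ^ 2) z.1 ×ˢ ball z.2 r := rfl
  -- Jensen on the slices
  have hJ : ∫⁻ w in parabolicCylinder r z, ‖⨍ y in ball z.2 r, p w.1 y‖ₑ ^ (3 / 2 : ℝ) ≤
      ∫⁻ w in parabolicCylinder r z, ‖p w.1 w.2‖ₑ ^ (3 / 2 : ℝ) := by
    rw [hQ] at hp ⊢
    exact lintegral_enorm_setAverage_slice_rpow_le hB0 hBtop (by norm_num) hp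
  -- the pointwise splitting
  have hpt : ∀ w : ℝ × EuclideanSpace ℝ (Fin 3), ‖p w.1 w.2 - ⨍ y in ball z.2 r, p w.1 y‖ₑ ^ (3 / 2 : ℝ) ≤
      2 * (‖p w.1 w.2‖ₑ ^ (3 / 2 : ℝ) + ‖⨍ y in ball z.2 r, p w.1 y‖ₑ ^ (3 / 2 : ℝ)) := by
    intro w
    calc ‖p w.1 w.2 - ⨍ y in ball z.2 r, p w.1 y‖ₑ ^ (3 / 2 : ℝ)
        ≤ (‖p w.1 w.2‖ₑ + ‖⨍ y in ball z.2 r, p w.1 y‖ₑ) ^ (3 / 2 : ℝ) := by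
          gcongr; exact enorm_sub_le
      _ ≤ (2 : ℝ≥0∞) ^ ((3 / 2 : ℝ) - 1) *
            (‖p w.1 w.2‖ₑ ^ (3 / 2 : ℝ) + ‖⨍ y in ball z.2 r, p w.1 y‖ₑ ^ (3 / 2 : ℝ)) :=
          ENNReal.rpow_add_le_mul_rpow_add_rpow _ _ (by norm_num)
      _ ≤ 2 * (‖p w.1 w.2‖ₑ ^ (3 / 2 : ℝ) + ‖⨍ y in ball z.2 r, p w.1 y‖ₑ ^ (3 / 2 : ℝ)) := by
          gcongr
          calc (2 : ℝ≥0∞) ^ ((3 / 2 : ℝ) - 1) ≤ 2 ^ (1 : ℝ) :=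
                ENNReal.rpow_le_rpow_of_exponent_le (by norm_num) (by norm_num)
            _ = 2 := ENNReal.rpow_one _
  have hmeas : AEMeasurable (fun w : ℝ × EuclideanSpace ℝ (Fin 3) => ‖p w.1 w.2‖ₑ ^ (3 / 2 : ℝ))
      (volume.restrict (parabolicCylinder r z)) := hp.enorm.pow_const _
  have hI : ∫⁻ w in parabolicCylinder r z, ‖p w.1 w.2 - ⨍ y in ball z.2 r, p w.1 y‖ₑ ^ (3 / 2 : ℝ) ≤
      4 * ∫⁻ w in parabolicCylinder r z, ‖p w.1 w.2‖ₑ ^ (3 / 2 : ℝ) := by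
    calc ∫⁻ w in parabolicCylinder r z, ‖p w.1 w.2 - ⨍ y in ball z.2 r, p w.1 y‖ₑ ^ (3 / 2 : ℝ)
        ≤ ∫⁻ w in parabolicCylinder r z,
            2 * (‖p w.1 w.2‖ₑ ^ (3 / 2 : ℝ) + ‖⨍ y in ball z.2 r, p w.1 y‖ₑ ^ (3 / 2 : ℝ)) :=
          lintegral_mono fun w => hpt w
      _ = 2 * ((∫⁻ w in parabolicCylinder r z, ‖p w.1 w.2‖ₑ ^ (3 / 2 : ℝ)) +
            ∫⁻ w in parabolicCylinder r z, ‖⨍ y in ball z.2 r, p w.1 y‖ₑ ^ (3 / 2 : ℝ)) := by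
          rw [lintegral_const_mul' _ _ ENNReal.ofNat_ne_top, lintegral_add_left' hmeas]
      _ ≤ 2 * ((∫⁻ w in parabolicCylinder r z, ‖p w.1 w.2‖ₑ ^ (3 / 2 : ℝ)) +
            ∫⁻ w in parabolicCylinder r z, ‖p w.1 w.2‖ₑ ^ (3 / 2 : ℝ)) := by gcongr
      _ = 4 * ∫⁻ w in parabolicCylinder r z, ‖p w.1 w.2‖ₑ ^ (3 / 2 : ℝ) := by
          rw [← two_mul, ← mul_assoc]; norm_num
  unfold cknDOsc cknD
  calc (ENNReal.ofReal r ^ 2)⁻¹ *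
        ∫⁻ w in parabolicCylinder r z, ‖p w.1 w.2 - ⨍ y in ball z.2 r, p w.1 y‖ₑ ^ (3 / 2 : ℝ)
      ≤ (ENNReal.ofReal r ^ 2)⁻¹ * (4 * ∫⁻ w in parabolicCylinder r z, ‖p w.1 w.2‖ₑ ^ (3 / 2 : ℝ)) := by
        gcongr
    _ = 4 * ((ENNReal.ofReal r ^ 2)⁻¹ * ∫⁻ w in parabolicCylinder r z, ‖p w.1 w.2‖ₑ ^ (3 / 2 : ℝ)) := by
        ring

/-- The sum `A + C + D_osc + E` of Albritton–Barker is at most `4 (A + E + C + D)` once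
`D_osc ≤ 4 D`. [folklore] -/
theorem abScaledSum_le_four_mul {r : ℝ} {z : ℝ × EuclideanSpace ℝ (Fin 3)} {u : ℝ → EuclideanSpace ℝ (Fin 3) → EuclideanSpace ℝ (Fin 3)} {p : ℝ → EuclideanSpace ℝ (Fin 3) → ℝ}
    {G : ℝ → EuclideanSpace ℝ (Fin 3) → EuclideanSpace ℝ (Fin 3) →L[ℝ] EuclideanSpace ℝ (Fin 3)} (h : cknDOsc r z p ≤ 4 * cknD r z p) :
    abScaledSum r z u p G ≤ 4 * (cknAEss r z u + cknE r z G + cknC r z u + cknD r z p) := by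
  have h4 : ∀ x : ℝ≥0∞, x ≤ 4 * x := fun x =>
    le_mul_of_one_le_left zero_le (by norm_num)
  calc abScaledSum r z u p G
      = cknAEss r z u + cknC r z u + cknDOsc r z p + cknE r z G := rfl
    _ ≤ 4 * cknAEss r z u + 4 * cknC r z u + 4 * cknD r z p + 4 * cknE r z G :=
        add_le_add (add_le_add (add_le_add (h4 _) (h4 _)) h) (h4 _)
    _ = 4 * (cknAEss r z u + cknE r z G + cknC r z u + cknD r z p) := by ring

/-- **Geometry of parabolic sub-balls.** If `Q(z', r') ⊆ Q(z, R)` with `r' > 0`, then the time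
window and the ball of `Q(z', r')` lie in those of `Q(z, R)`, and the centre `x'` lies in
`B(x, R)`. [folklore] -/
theorem parabolicCylinder_subset_data {r' R : ℝ} {z z' : ℝ × EuclideanSpace ℝ (Fin 3)} (hr' : 0 < r')
    (h : parabolicCylinder r' z' ⊆ parabolicCylinder R z) :
    Ioo (z'.1 - r' ^ 2) z'.1 ⊆ Ioo (z.1 - R ^ 2) z.1 ∧ ball z'.2 r' ⊆ ball z.2 R ∧
      z.1 - R ^ 2 ≤ z'.1 - r' ^ 2 ∧ z'.1 ≤ z.1 ∧ dist z'.2 z.2 < R := by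
  have hI0 : z'.1 - r' ^ 2 < z'.1 := by nlinarith
  have hne : (Ioo (z'.1 - r' ^ 2) z'.1 ×ˢ ball z'.2 r').Nonempty :=
    (nonempty_Ioo.2 hI0).prod (nonempty_ball.2 hr')
  have h2 := (prod_subset_prod_iff' hne).1 h
  have h3 := (Ioo_subset_Ioo_iff hI0).1 h2.1
  exact ⟨h2.1, h2.2, h3.1, h3.2, mem_ball.1 (h2.2 (mem_ball_self hr'))⟩

/-- **The enlarged ball at a sub-ball's centre.** If `Q(z', r') ⊆ Q(z, R)` with `r' > 0` and
`R ≤ 1`, then `Q(z', 1 - R)` has its time window in `]t - 1, t[` and its ball in `B(x, 1)`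
(`dist(x', x) < R` and `R² + (1 - R)² ≤ 1`); in particular `Q(z', 1 - R) ⊆ Q(z, 1)`. [folklore] -/
theorem parabolicCylinder_subset_enlarge {r' R : ℝ} {z z' : ℝ × EuclideanSpace ℝ (Fin 3)} (hr' : 0 < r') (hR : R ≤ 1)
    (h : parabolicCylinder r' z' ⊆ parabolicCylinder R z) :
    Ioo (z'.1 - (1 - R) ^ 2) z'.1 ⊆ Ioo (z.1 - 1 ^ 2) z.1 ∧ ball z'.2 (1 - R) ⊆ ball z.2 1 := by
  obtain ⟨-, -, ht1, ht2, hd⟩ := parabolicCylinder_subset_data hr' h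
  have hR0 : 0 < R := dist_nonneg.trans_lt hd
  refine ⟨Ioo_subset_Ioo (by nlinarith) ht2, ball_subset_ball' (by linarith [hd.le])⟩

/-- The time window and the ball of a sub-ball `Q(z', r') ⊆ Q(z, R)`, `R ≤ 1`, lie in those of
`Q(z, 1)`. [folklore] -/
theorem parabolicCylinder_subset_data_one {r' R : ℝ} {z z' : ℝ × EuclideanSpace ℝ (Fin 3)} (hr' : 0 < r') (hR : R ≤ 1)
    (h : parabolicCylinder r' z' ⊆ parabolicCylinder R z) :
    Ioo (z'.1 - r' ^ 2) z'.1 ⊆ Ioo (z.1 - 1 ^ 2) z.1 ∧ ball z'.2 r' ⊆ ball z.2 1 := by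
  obtain ⟨hI, hB, -, -, hd⟩ := parabolicCylinder_subset_data hr' h
  have hR0 : 0 < R := dist_nonneg.trans_lt hd
  refine ⟨hI.trans (Ioo_subset_Ioo (by nlinarith) le_rfl), hB.trans (ball_subset_ball hR)⟩

/-- A parabolic ball is the product of its time window and its ball, so inclusions of both give
an inclusion of parabolic balls. [folklore] -/
theorem parabolicCylinder_subset_of_data {r r' : ℝ} {z z' : ℝ × EuclideanSpace ℝ (Fin 3)}
    (hI : Ioo (z'.1 - r' ^ 2) z'.1 ⊆ Ioo (z.1 - r ^ 2) z.1) (hB : ball z'.2 r' ⊆ ball z.2 r) :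
    parabolicCylinder r' z' ⊆ parabolicCylinder r z :=
  prod_mono hI hB

/-- **The background quantities of a suitable weak solution in `Q(z, 1)`** (Albritton–Barker
2019, remark after Lemma 2.6: the estimate "depends on the background quantities `C(1)` and
`D(1)`"). For a suitable weak solution in the sense of Def. 2.1 on `Q(z, 1)` and any weak
spatial gradient `G` of `u` there, `A(1; z)`, `E(1; z)`, `C(1; z)`, `D(1; z)` are finite: `A`
and `D` by the global class, `E` by the global class of SOME weak gradient and the a.e.
uniqueness of weak gradients, `C` by the multiplicative inequality.
[cite: AlbrittonBarker2019, Def. 2.1 and remark after Lemma 2.6] -/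
theorem background_finite {z : ℝ × EuclideanSpace ℝ (Fin 3)} {u : ℝ → EuclideanSpace ℝ (Fin 3) → EuclideanSpace ℝ (Fin 3)} {p : ℝ → EuclideanSpace ℝ (Fin 3) → ℝ}
    (hsw : IsSuitableWeakSolutionInBall 1 z u p) {G : ℝ → EuclideanSpace ℝ (Fin 3) → EuclideanSpace ℝ (Fin 3) →L[ℝ] EuclideanSpace ℝ (Fin 3)}
    (hG : HasWeakSpatialGradientOn (parabolicCylinderOpens 1 z) u G) :
    cknAEss 1 z u ≠ ∞ ∧ cknE 1 z G ≠ ∞ ∧ cknC 1 z u ≠ ∞ ∧ cknD 1 z p ≠ ∞ ∧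
      AEStronglyMeasurable (uncurry p) (volume.restrict (parabolicCylinder 1 z)) := by
  obtain ⟨-, ⟨CA, hCA⟩, ⟨G', hG', hG'int⟩, hpLp⟩ := hsw
  -- `A(1)`
  have hA : cknAEss 1 z u ≠ ∞ := by
    have hbound : ∀ᵐ t ∂(volume.restrict (Ioo (z.1 - 1 ^ 2) z.1)),
        (ENNReal.ofReal (1 : ℝ))⁻¹ * ∫⁻ x in ball z.2 1, ‖u t x‖ₑ ^ 2 ≤ CA := by
      filter_upwards [hCA] with t ht
      rwa [ENNReal.ofReal_one, inv_one, one_mul]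
    exact ne_top_of_le_ne_top ENNReal.coe_ne_top (essSup_le_of_ae_le _ hbound)
  -- `E(1)` through the a.e. uniqueness of weak gradients
  have hE : cknE 1 z G ≠ ∞ := by
    have hae := hG.ae_eq hG'
    rw [coe_parabolicCylinderOpens] at hae
    have heq : ∫⁻ w in parabolicCylinder 1 z, ENNReal.ofReal (frobeniusNormSq (G w.1 w.2)) =
        ∫⁻ w in parabolicCylinder 1 z, ENNReal.ofReal (frobeniusNormSq (G' w.1 w.2)) := by
      refine lintegral_congr_ae ?_
      filter_upwards [hae] with w hw
      have hw' : G w.1 w.2 = G' w.1 w.2 := hw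
      rw [hw']
    rw [cknE, ENNReal.ofReal_one, inv_one, one_mul, heq]
    exact hG'int.ne
  -- `D(1)`
  have hD : cknD 1 z p ≠ ∞ := by
    obtain ⟨-, h32top, h32r⟩ := threeHalves_facts
    have h32ne : (3 / 2 : ℝ≥0∞) ≠ 0 := by norm_num
    have := lintegral_rpow_enorm_lt_top_of_eLpNorm_lt_top h32ne h32top hpLp.eLpNorm_lt_top
    rw [h32r] at this
    rw [cknD, ENNReal.ofReal_one, one_pow, inv_one, one_mul]
    exact this.ne
  -- `C(1)` by the multiplicative inequality
  have hC : cknC 1 z u ≠ ∞ := by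
    obtain ⟨C₀, hC₀⟩ := Seregin2020.exists_cknC_le_finer
    refine ne_top_of_le_ne_top ?_ (hC₀ u G z 1 one_pos hG hA hE)
    exact ENNReal.mul_ne_top (ENNReal.mul_ne_top ENNReal.coe_ne_top
      (ENNReal.rpow_ne_top_of_nonneg (by norm_num) hA))
      (ENNReal.rpow_ne_top_of_nonneg (by norm_num) (ENNReal.add_ne_top.2 ⟨hA, hE⟩))
  exact ⟨hA, hE, hC, hD, hpLp.aestronglyMeasurable⟩

/-- A finite bound above each member of a finite nested supremum of the kind entering
Albritton–Barker's hypothesis `sup_{Q' ⊂ Q} F(Q') < ∞`. [folklore] -/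
theorem exists_bound_of_iSup_lt_top {F : ℝ → (ℝ × EuclideanSpace ℝ (Fin 3)) → ℝ≥0∞} {ω : Set (ℝ × EuclideanSpace ℝ (Fin 3))}
    (h : (⨆ (r : ℝ) (_ : 0 < r) (z' : ℝ × EuclideanSpace ℝ (Fin 3)) (_ : parabolicCylinder r z' ⊆ ω), F r z') < ∞) :
    ∃ M : ℝ≥0, ∀ (r : ℝ) (z' : ℝ × EuclideanSpace ℝ (Fin 3)), 0 < r → parabolicCylinder r z' ⊆ ω → F r z' ≤ M := by
  refine ⟨(⨆ (r : ℝ) (_ : 0 < r) (z' : ℝ × EuclideanSpace ℝ (Fin 3)) (_ : parabolicCylinder r z' ⊆ ω), F r z').toNNReal,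
    fun r z' hr hω => ?_⟩
  rw [ENNReal.coe_toNNReal h.ne]
  exact le_iSup_of_le r <| le_iSup_of_le hr <| le_iSup_of_le z' <| le_iSup_of_le hω le_rfl

/-- **Albritton–Barker 2019, Lemma 2.6 (Morrey-type estimates), rescaled-energy cases —
discharged.** For a suitable weak solution `(u, p)` in `Q(z, 1)` (Def. 2.1), a weak spatial
gradient `G` of `u` there, and ONE of `sup_{Q' ⊂ Q(z,1)} A(Q')`, `sup C(Q')`, `sup E(Q')` finite,
`𝐈(Q(z, R)) < ∞` for every `0 < R < 1`. Proof: Seregin's centred estimates with uniform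
constants (`Seregin2020.scaledEnergies_bounded_of_cknC_le_unif / _of_cknAEss_le_unif /
_of_cknE_le_unif`) at every centre `z'` of a sub-ball `Q(z', r') ⊆ Q(z, R)` with base radius
`δ = 1 - R` (`Q(z', δ) ⊆ Q(z, 1)`), the background quantities at radius `δ` and the sub-balls of
radius `r' > δ/2` being controlled by `A(1), E(1), C(1), D(1) < ∞` (`background_finite`), and
`D_osc ≤ 4 D` (`cknDOsc_le_mul_cknD`).
[cite: AlbrittonBarker2019, Lemma 2.6 (arXiv:1811.00502 §2); centred estimates Seregin2006 Lemma 2.1] -/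
theorem albrittonBarker2019_lemma_2_6_holds : albrittonBarker2019_lemma_2_6 := by
  intro z u p hsw G hG hcases R hR0 hR1
  -- ### notation and background
  have hswQ : IsSuitableWeakSolutionOn (parabolicCylinderOpens 1 z) 1 0 u p := hsw.1
  obtain ⟨hA1, hE1, hC1, hD1, hpmeas⟩ := background_finite hsw hG
  set δ : ℝ := 1 - R with hδdef
  have hδ : 0 < δ := by rw [hδdef]; linarith
  have hR1' : R ≤ 1 := hR1.le
  have hQ1 : ∀ {r' : ℝ} {z' : ℝ × EuclideanSpace ℝ (Fin 3)}, 0 < r' → parabolicCylinder r' z' ⊆ parabolicCylinder R z →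
      parabolicCylinder δ z' ⊆ ((parabolicCylinderOpens 1 z : Opens (ℝ × EuclideanSpace ℝ (Fin 3))) : Set (ℝ × EuclideanSpace ℝ (Fin 3))) := by
    intro r' z' hr' h
    obtain ⟨hI, hB⟩ := parabolicCylinder_subset_enlarge hr' hR1' h
    rw [coe_parabolicCylinderOpens]
    exact parabolicCylinder_subset_of_data hI hB
  -- background bounds at radius `δ` at every admissible centre
  set A₀ : ℝ≥0∞ := ENNReal.ofReal (1 / δ) * cknAEss 1 z u with hA₀
  set E₀ : ℝ≥0∞ := ENNReal.ofReal (1 / δ) * cknE 1 z G with hE₀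
  set D₀ : ℝ≥0∞ := ENNReal.ofReal (1 / δ) ^ 2 * cknD 1 z p with hD₀
  have hA₀top : A₀ ≠ ∞ := ENNReal.mul_ne_top ENNReal.ofReal_ne_top hA1
  have hE₀top : E₀ ≠ ∞ := ENNReal.mul_ne_top ENNReal.ofReal_ne_top hE1
  have hD₀top : D₀ ≠ ∞ := ENNReal.mul_ne_top (ENNReal.pow_ne_top ENNReal.ofReal_ne_top) hD1
  have hbg : ∀ {r' : ℝ} {z' : ℝ × EuclideanSpace ℝ (Fin 3)}, 0 < r' → parabolicCylinder r' z' ⊆ parabolicCylinder R z →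
      cknAEss δ z' u ≤ (A₀.toNNReal : ℝ≥0∞) ∧ cknE δ z' G ≤ (E₀.toNNReal : ℝ≥0∞) ∧
        cknD δ z' p ≤ (D₀.toNNReal : ℝ≥0∞) := by
    intro r' z' hr' h
    obtain ⟨hI, hB⟩ := parabolicCylinder_subset_enlarge hr' hR1' h
    have hsub : parabolicCylinder δ z' ⊆ parabolicCylinder 1 z := parabolicCylinder_subset_of_data hI hB
    rw [ENNReal.coe_toNNReal hA₀top, ENNReal.coe_toNNReal hE₀top, ENNReal.coe_toNNReal hD₀top]
    exact ⟨cknAEss_le_mul_of_subset one_pos hδ hI hB u, cknE_le_mul_of_subset one_pos hδ hsub G,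
      cknD_le_mul_of_subset one_pos hδ hsub p⟩
  -- every sub-ball of an admissible `Q(z', δ)` is a sub-ball of `Q(z, 1)`
  have hsubδ : ∀ {r' : ℝ} {z' : ℝ × EuclideanSpace ℝ (Fin 3)}, 0 < r' → parabolicCylinder r' z' ⊆ parabolicCylinder R z →
      ∀ ρ ∈ Ioc (0 : ℝ) δ, parabolicCylinder ρ z' ⊆ parabolicCylinder 1 z := by
    intro r' z' hr' h ρ hρ
    obtain ⟨hI, hB⟩ := parabolicCylinder_subset_enlarge hr' hR1' h
    exact (parabolicCylinder_mono hρ.1.le hρ.2 z').trans (parabolicCylinder_subset_of_data hI hB)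
  -- ### small radii: the uniform centred estimate, case by case
  have hsmall : ∃ K : ℝ≥0, ∀ (r' : ℝ) (z' : ℝ × EuclideanSpace ℝ (Fin 3)), 0 < r' → r' ≤ δ / 2 →
      parabolicCylinder r' z' ⊆ parabolicCylinder R z →
      cknAEss r' z' u + cknE r' z' G + cknC r' z' u + cknD r' z' p ≤ K := by
    rcases hcases with hA | hC | hE
    · -- the case `A`
      obtain ⟨M, hM⟩ := exists_bound_of_iSup_lt_top hA
      obtain ⟨K, hK⟩ := Seregin2020.scaledEnergies_bounded_of_cknAEss_le_unif M E₀.toNNReal D₀.toNNReal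
      refine ⟨K, fun r' z' hr' hr'δ h => ?_⟩
      obtain ⟨-, hEb, hDb⟩ := hbg hr' h
      exact hK _ u p G hswQ hG z' δ hδ (hQ1 hr' h) hEb hDb
        (fun ρ hρ => hM ρ z' hρ.1 (hsubδ hr' h ρ hρ)) r' ⟨hr', hr'δ⟩
    · -- the case `C`
      obtain ⟨M, hM⟩ := exists_bound_of_iSup_lt_top hC
      obtain ⟨K, hK⟩ := Seregin2020.scaledEnergies_bounded_of_cknC_le_unif M D₀.toNNReal
      refine ⟨K, fun r' z' hr' hr'δ h => ?_⟩
      obtain ⟨-, -, hDb⟩ := hbg hr' h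
      exact hK _ u p G hswQ hG z' δ hδ (hQ1 hr' h) hDb
        (fun ρ hρ => hM ρ z' hρ.1 (hsubδ hr' h ρ hρ)) r' ⟨hr', hr'δ⟩
    · -- the case `E`
      obtain ⟨M, hM⟩ := exists_bound_of_iSup_lt_top hE
      obtain ⟨K, hK⟩ := Seregin2020.scaledEnergies_bounded_of_cknE_le_unif M A₀.toNNReal D₀.toNNReal
      refine ⟨K, fun r' z' hr' hr'δ h => ?_⟩
      obtain ⟨hAb, -, hDb⟩ := hbg hr' h
      exact hK _ u p G hswQ hG z' δ hδ (hQ1 hr' h) hAb hDb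
        (fun ρ hρ => hM ρ z' hρ.1 (hsubδ hr' h ρ hρ)) r' ⟨hr', hr'δ⟩
  obtain ⟨K, hK⟩ := hsmall
  -- ### large radii: direct comparison with the background quantities
  set L : ℝ≥0∞ := ENNReal.ofReal (2 / δ) * cknAEss 1 z u + ENNReal.ofReal (2 / δ) ^ 2 * cknC 1 z u +
    4 * (ENNReal.ofReal (2 / δ) ^ 2 * cknD 1 z p) + ENNReal.ofReal (2 / δ) * cknE 1 z G with hL
  have hLtop : L ≠ ∞ := ENNReal.add_ne_top.2 ⟨ENNReal.add_ne_top.2 ⟨ENNReal.add_ne_top.2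
    ⟨ENNReal.mul_ne_top ENNReal.ofReal_ne_top hA1,
      ENNReal.mul_ne_top (ENNReal.pow_ne_top ENNReal.ofReal_ne_top) hC1⟩,
      ENNReal.mul_ne_top ENNReal.ofNat_ne_top
        (ENNReal.mul_ne_top (ENNReal.pow_ne_top ENNReal.ofReal_ne_top) hD1)⟩,
    ENNReal.mul_ne_top ENNReal.ofReal_ne_top hE1⟩
  have hlarge : ∀ (r' : ℝ) (z' : ℝ × EuclideanSpace ℝ (Fin 3)), δ / 2 < r' →
      parabolicCylinder r' z' ⊆ parabolicCylinder R z → abScaledSum r' z' u p G ≤ L := by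
    intro r' z' hr'δ h
    have hr' : 0 < r' := (half_pos hδ).trans hr'δ
    obtain ⟨hI, hB⟩ := parabolicCylinder_subset_data_one hr' hR1' h
    have hsub : parabolicCylinder r' z' ⊆ parabolicCylinder 1 z := parabolicCylinder_subset_of_data hI hB
    have hratio : 1 / r' ≤ 2 / δ := by
      rw [div_le_div_iff₀ hr' hδ]; linarith
    have h1 : ENNReal.ofReal (1 / r') ≤ ENNReal.ofReal (2 / δ) := ENNReal.ofReal_le_ofReal hratio
    have hDosc : cknDOsc r' z' p ≤ 4 * cknD r' z' p :=
      cknDOsc_le_mul_cknD hr' z' (hpmeas.mono_measure (Measure.restrict_mono hsub le_rfl))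
    calc abScaledSum r' z' u p G
        = cknAEss r' z' u + cknC r' z' u + cknDOsc r' z' p + cknE r' z' G := rfl
      _ ≤ ENNReal.ofReal (1 / r') * cknAEss 1 z u + ENNReal.ofReal (1 / r') ^ 2 * cknC 1 z u +
          4 * (ENNReal.ofReal (1 / r') ^ 2 * cknD 1 z p) + ENNReal.ofReal (1 / r') * cknE 1 z G := by
          gcongr
          · exact cknAEss_le_mul_of_subset one_pos hr' hI hB u
          · exact Seregin2020.cknC_le_mul_of_subset one_pos hr' hsub u
          · exact hDosc.trans (by gcongr; exact cknD_le_mul_of_subset one_pos hr' hsub p)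
          · exact cknE_le_mul_of_subset one_pos hr' hsub G
      _ ≤ L := by rw [hL]; gcongr
  -- ### conclusion
  have hbound : typeIBound (parabolicCylinder R z) u p G ≤ 4 * K + L := by
    refine typeIBound_le_iff.2 fun r' hr' z' h => ?_
    rcases le_or_gt r' (δ / 2) with hle | hlt
    · have hsub : parabolicCylinder r' z' ⊆ parabolicCylinder 1 z :=
        h.trans (parabolicCylinder_mono hR0.le hR1' z)
      have hDosc : cknDOsc r' z' p ≤ 4 * cknD r' z' p :=
        cknDOsc_le_mul_cknD hr' z' (hpmeas.mono_measure (Measure.restrict_mono hsub le_rfl))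
      calc abScaledSum r' z' u p G
          ≤ 4 * (cknAEss r' z' u + cknE r' z' G + cknC r' z' u + cknD r' z' p) :=
            abScaledSum_le_four_mul hDosc
        _ ≤ 4 * K := by gcongr; exact hK r' z' hr' hle h
        _ ≤ 4 * K + L := le_self_add
    · exact (hlarge r' z' hlt h).trans le_add_self
  refine lt_of_le_of_lt hbound ?_
  exact ENNReal.add_lt_top.2 ⟨ENNReal.mul_lt_top ENNReal.ofNat_lt_top ENNReal.coe_lt_top,
    hLtop.lt_top⟩

end Assembly

end Literature.Analysis.FluidPDE
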